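import Literature.Analysis.FluidPDE.ParabolicCutoffProfile
import Literature.Analysis.FluidPDE.BackwardHeatKernels
import Mathlib.MeasureTheory.Function.L2Space
import HarnessLib

/-!
# The pointwise interior estimate for the backward heat inequality

Analysis/FluidPDE support file (everything proved, no definitions) on the discharge path of the
named fact `Literature.Analysis.FluidPDE.Carleman.seregin_backwardHeat_localMax_le_L2`
(`BackwardHeatRegularity.lean`; Seregin 2014, App. A.2, Remark A.2: for `u` with
`|∂ₜu + Δu| ≤ c₁(|u| + |∇u|)` in `Q(R, T)`, `max_{Q(3R/4, 3T/4)} (|u| + √T|∇u|) ≤ c₃ ‖u‖_{L²(Q(R,T))}`,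
quoted from the regularity theory of parabolic equations). This file proves the **one-step
pointwise estimate** from which the local maximum estimate follows by iteration
(`BackwardHeatLocalMaxProofs.lean`): for `u ∈ C²(U; F)` with `‖∂ₜu + Δₓu‖ ≤ c₁ (‖u‖ + |∇ₓu|)` on an
open `U ⊆ ℝ × E`, a point `z₀ = (s₀, y₀)`, a scale `0 < ρ ≤ 1` with the closed future cylinder
`C⁺ = [s₀, s₀ + ρ²] × B̄(y₀, ρ)` inside `U` together with a collar below it, and any bound `S` for
`‖u‖ + |∇ₓu|` on `C⁺`,

  `‖u(z₀)‖ + |∇ₓu(z₀)| ≤ c₁ C ρ S + (1 + c₁) C ρ^{-(d+3)} ‖u‖_{L²(C⁺)}`     (`pointwise_estimate`)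

with `C = C(E)`, `d = dim E`. The small factor `c₁ C ρ` in front of `S` is what makes the
iteration over shrinking cylinders converge.

## Proof

Multiply a component `u_c = ⟪u, c⟫` (`‖c‖ ≤ 1`) by the square `Φ = Θ²` of the localised cut-off
`Θ` of `ParabolicCutoffProfile.exists_localisedCutoff` and represent `W = Φ u_c` and `∂ᵥW` at
`z₀` through the backward heat kernels (`HeatPotentialRepresentation`:
`W(z₀) = -∫ k_G (∂ₜW + ΔW)`, `∂ᵥW(z₀) = ∫ k_v (∂ₜW + ΔW)`). The source
`∂ₜW + ΔW = Φ(∂ₜu_c + Δu_c) + (∂ₜΦ + ΔΦ)u_c + 2∇Φ·∇u_c` is estimated term by term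
(`abs_dt_add_lap_cutoff_mul_inner_le`): on the first term the kernels contribute their slab
integrals `ρ²`, `2^{d/2+1}ρ` (`BackwardHeatKernels`) against `sup_{C⁺}(‖u‖ + |∇u|) ≤ S`; the two
cut-off terms live on the parabolic shell where the kernels are bounded by `B ρ^{-(d+1)}`
(`exists_shell_bound`) and are controlled by `‖u‖_{L²}` directly and through Caccioppoli's
inequality (`BackwardHeatCaccioppoli.integral_mul_sq_mul_gradSq_le`, applied with the cut-off `Θ`
and a monotone time weight vanishing on the collar). The collar below `s₀` — needed only to make
the cut-off products globally `C²` — is invisible to the kernels and is removed at the end by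
letting its width tend to zero.

## References

* O. A. Ladyženskaja, V. A. Solonnikov, N. N. Ural'ceva, *Linear and quasi-linear equations of
  parabolic type*, AMS 1968, Ch. III §§7–8, Ch. IV §1.
* G. M. Lieberman, *Second order parabolic differential equations*, World Scientific 1996,
  Ch. IV (interior estimates via the fundamental solution), Ch. VI §6.
* G. Seregin, *Lecture notes on regularity theory for the Navier–Stokes equations*, World
  Scientific 2014, App. A.2, Remark A.2.
-/

noncomputable section

open MeasureTheory Set Function Filter Metric Real
open scoped Topology RealInnerProductSpace ENNReal

namespace Literature.Analysis.FluidPDE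

namespace Carleman

variable {E : Type*} [NormedAddCommGroup E] [InnerProductSpace ℝ E] [FiniteDimensional ℝ E]
  [MeasurableSpace E] [BorelSpace E]
variable {F : Type*} [NormedAddCommGroup F] [InnerProductSpace ℝ F]

/-! ### Cauchy–Schwarz on sets of finite measure, volumes of cylinders -/

section Tools

/-- **Cauchy–Schwarz on a finite measure space**: `∫ f ≤ √(μ(univ) ∫ f²)` for `f ≥ 0` with `f²`
integrable (Hölder with `p = q = 2` against the constant `1`). [folklore] -/
theorem integral_le_sqrt_measure_mul_integral_sq {X : Type*} [MeasurableSpace X] {μ : Measure X}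
    [IsFiniteMeasure μ] {f : X → ℝ} (hf0 : 0 ≤ᵐ[μ] f) (hfm : AEStronglyMeasurable f μ)
    (hf2 : Integrable (fun x => f x ^ 2) μ) :
    ∫ x, f x ∂μ ≤ Real.sqrt (μ.real univ * ∫ x, f x ^ 2 ∂μ) := by
  have hf : MemLp f 2 μ := (memLp_two_iff_integrable_sq hfm).2 hf2
  have h1 : MemLp (fun _ : X => (1 : ℝ)) 2 μ := memLp_const 1
  have h2 : ENNReal.ofReal (2 : ℝ) = 2 := by simp
  have hH := integral_mul_le_Lp_mul_Lq_of_nonneg (μ := μ) Real.HolderConjugate.two_two hf0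
    (ae_of_all _ fun _ => zero_le_one) (by rw [h2]; exact hf) (by rw [h2]; exact h1)
  simp only [mul_one, one_rpow, integral_const, smul_eq_mul] at hH
  have hI0 : 0 ≤ ∫ x, f x ^ 2 ∂μ := integral_nonneg fun x => sq_nonneg _
  calc ∫ x, f x ∂μ ≤ (∫ x, f x ^ (2 : ℝ) ∂μ) ^ (1 / (2 : ℝ)) * (μ.real univ) ^ (1 / (2 : ℝ)) := hH
    _ = Real.sqrt (μ.real univ * ∫ x, f x ^ 2 ∂μ) := by
        rw [Real.sqrt_eq_rpow, Real.mul_rpow measureReal_nonneg hI0, mul_comm]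
        congr 2
        refine integral_congr_ae (Eventually.of_forall fun x => ?_)
        exact Real.rpow_two _

/-- **Cauchy–Schwarz on a set of finite measure**: `∫_s f ≤ √(vol(s) ∫_s f²)` for `f ≥ 0` on `s`,
`f` measurable and `f²` integrable on `s`. [folklore] -/
theorem setIntegral_le_sqrt_measure_mul_setIntegral_sq {X : Type*} [MeasurableSpace X]
    {μ : Measure X} {s : Set X} (hs : μ s ≠ ∞) (hsm : MeasurableSet s) {f : X → ℝ}
    (hf0 : ∀ x ∈ s, 0 ≤ f x) (hfm : AEStronglyMeasurable f (μ.restrict s))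
    (hf2 : IntegrableOn (fun x => f x ^ 2) s μ) :
    ∫ x in s, f x ∂μ ≤ Real.sqrt (μ.real s * ∫ x in s, f x ^ 2 ∂μ) := by
  haveI : IsFiniteMeasure (μ.restrict s) := ⟨by rwa [Measure.restrict_apply_univ, lt_top_iff_ne_top]⟩
  have h := integral_le_sqrt_measure_mul_integral_sq (μ := μ.restrict s)
    ((ae_restrict_mem hsm).mono hf0) hfm hf2
  rwa [measureReal_restrict_apply_univ] at h

/-- The volume of a time-space box `[a, b] × B̄(y₀, r)`. [folklore] -/
theorem volume_Icc_prod_closedBall (a b : ℝ) (y₀ : E) (r : ℝ) :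
    volume (Icc a b ×ˢ closedBall y₀ r) = ENNReal.ofReal (b - a) * volume (closedBall y₀ r) := by
  rw [Measure.volume_eq_prod, Measure.prod_prod, Real.volume_Icc]

/-- The volume of a time-space box `[a, b) × B̄(y₀, r)`. [folklore] -/
theorem volume_Ico_prod_closedBall (a b : ℝ) (y₀ : E) (r : ℝ) :
    volume (Ico a b ×ˢ closedBall y₀ r) = ENNReal.ofReal (b - a) * volume (closedBall y₀ r) := by
  rw [Measure.volume_eq_prod, Measure.prod_prod, Real.volume_Ico]

/-- Balls of radius `≤ 1` have volume at most that of the unit ball. [folklore] -/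
theorem volume_closedBall_le_unit (y₀ : E) {r : ℝ} (hr : r ≤ 1) :
    volume (closedBall y₀ r) ≤ volume (closedBall (0 : E) 1) := by
  rw [Measure.addHaar_closedBall_center volume y₀ r]
  exact measure_mono (closedBall_subset_closedBall hr)

/-- The unit-ball volume is finite and the box volumes are finite. [folklore] -/
theorem volume_Icc_prod_closedBall_lt_top (a b : ℝ) (y₀ : E) (r : ℝ) :
    volume (Icc a b ×ˢ closedBall y₀ r) < ∞ := by
  rw [volume_Icc_prod_closedBall]
  exact ENNReal.mul_lt_top ENNReal.ofReal_lt_top measure_closedBall_lt_top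

/-- `√(a + b) ≤ √a + √b` (local copy of an elementary inequality). [folklore] -/
private theorem sqrt_add_le_sqrt_add_sqrt {a b : ℝ} (ha : 0 ≤ a) (hb : 0 ≤ b) :
    Real.sqrt (a + b) ≤ Real.sqrt a + Real.sqrt b := by
  rw [Real.sqrt_le_left (add_nonneg (Real.sqrt_nonneg _) (Real.sqrt_nonneg _))]
  nlinarith [Real.sq_sqrt ha, Real.sq_sqrt hb, Real.sqrt_nonneg a, Real.sqrt_nonneg b]

end Tools

/-! ### The source of a cut-off component -/

section Source

variable {U : Set (ℝ × E)} {u : ℝ × E → F} {c₁ : ℝ}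

omit [MeasurableSpace E] [BorelSpace E] in
/-- **The source of a cut-off component.** For `u ∈ C²(U; F)` with
`‖∂ₜu + Δₓu‖ ≤ c₁(‖u‖ + |∇ₓu|)` on the open set `U`, a `C²` cut-off `Φ` with `tsupport Φ ⊆ U`
and `‖c‖ ≤ 1`, the function `W = Φ ⟪u, c⟫` satisfies at every point
`|∂ₜW + ΔₓW| ≤ |Φ| c₁ (‖u‖ + |∇ₓu|) + |∂ₜΦ + ΔₓΦ| ‖u‖ + 2 |∇ₓΦ| |∇ₓu|`. [folklore] -/
theorem abs_dt_add_lap_cutoff_smul_inner_le (hU : IsOpen U) (hu : ContDiffOn ℝ 2 u U)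
    (hc₁ : 0 ≤ c₁)
    (hineq : ∀ z ∈ U, ‖dt u z + lap u z‖ ≤ c₁ * (‖u z‖ + Real.sqrt (gradSq u z)))
    {Φ : ℝ × E → ℝ} (hΦ : ContDiff ℝ 2 Φ) (hΦU : tsupport Φ ⊆ U) {c : F} (hc : ‖c‖ ≤ 1)
    (w : ℝ × E) :
    |dt (fun z => Φ z • ⟪u z, c⟫) w + lap (fun z => Φ z • ⟪u z, c⟫) w| ≤
      |Φ w| * (c₁ * (‖u w‖ + Real.sqrt (gradSq u w))) + |dt Φ w + lap Φ w| * ‖u w‖ +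
        2 * Real.sqrt (gradSq Φ w) * Real.sqrt (gradSq u w) := by
  set b := stdOrthonormalBasis ℝ E with hb
  set uc : ℝ × E → ℝ := fun z => ⟪u z, c⟫ with huc
  have hucU : ContDiffOn ℝ 2 uc U := contDiffOn_inner_const hu
  have hΦ1 : ContDiff ℝ 1 Φ := hΦ.of_le (by norm_num)
  have hucd : DifferentiableOn ℝ uc U := hucU.differentiableOn (by norm_num)
  have hsrc : dt (fun z => Φ z • uc z) w + lap (fun z => Φ z • uc z) w =
      Φ w • (dt uc w + lap uc w) + (dt Φ w + lap Φ w) • uc w +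
        (2 : ℝ) • ∑ i, dx (b i) Φ w • dx (b i) uc w := by
    rw [dt_cutoff_smul hU hΦ1 hΦU hucd w, lap_cutoff_smul hU hΦ hΦU hucU w]
    simp only [smul_add, add_smul, hb]
    abel
  have hnn : 0 ≤ |Φ w| * (c₁ * (‖u w‖ + Real.sqrt (gradSq u w))) + |dt Φ w + lap Φ w| * ‖u w‖ +
      2 * Real.sqrt (gradSq Φ w) * Real.sqrt (gradSq u w) := by positivity
  by_cases hw : w ∈ U
  · have hud : DifferentiableAt ℝ u w :=
      (hu.differentiableOn (by norm_num)).differentiableAt (hU.mem_nhds hw)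
    have e1 : dt uc w + lap uc w = ⟪dt u w + lap u w, c⟫ := by
      rw [huc, dt_inner_const hud, lap_inner_const hU hu hw, inner_add_left]
    have e2 : ∀ i, dx (b i) uc w = ⟪dx (b i) u w, c⟫ := fun i => dx_inner_const hud _
    show |dt (fun z => Φ z • uc z) w + lap (fun z => Φ z • uc z) w| ≤ _
    rw [hsrc, e1]
    simp only [e2, smul_eq_mul]
    -- the three terms
    have t1 : |Φ w * ⟪dt u w + lap u w, c⟫| ≤ |Φ w| * (c₁ * (‖u w‖ + Real.sqrt (gradSq u w))) := by
      rw [abs_mul]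
      refine mul_le_mul_of_nonneg_left ?_ (abs_nonneg _)
      calc |⟪dt u w + lap u w, c⟫| ≤ ‖dt u w + lap u w‖ * ‖c‖ := abs_real_inner_le_norm _ _
        _ ≤ ‖dt u w + lap u w‖ * 1 := mul_le_mul_of_nonneg_left hc (norm_nonneg _)
        _ ≤ c₁ * (‖u w‖ + Real.sqrt (gradSq u w)) := by rw [mul_one]; exact hineq w hw
    have t2 : |(dt Φ w + lap Φ w) * ⟪u w, c⟫| ≤ |dt Φ w + lap Φ w| * ‖u w‖ := by
      rw [abs_mul]
      refine mul_le_mul_of_nonneg_left ?_ (abs_nonneg _)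
      calc |⟪u w, c⟫| ≤ ‖u w‖ * ‖c‖ := abs_real_inner_le_norm _ _
        _ ≤ ‖u w‖ * 1 := mul_le_mul_of_nonneg_left hc (norm_nonneg _)
        _ = ‖u w‖ := mul_one _
    have t3 : |2 * ∑ i, dx (b i) Φ w * ⟪dx (b i) u w, c⟫| ≤
        2 * Real.sqrt (gradSq Φ w) * Real.sqrt (gradSq u w) := by
      rw [abs_mul, abs_two, mul_assoc]
      refine mul_le_mul_of_nonneg_left ?_ zero_le_two
      calc |∑ i, dx (b i) Φ w * ⟪dx (b i) u w, c⟫|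
          ≤ ∑ i, |dx (b i) Φ w * ⟪dx (b i) u w, c⟫| := Finset.abs_sum_le_sum_abs _ _
        _ ≤ ∑ i, |dx (b i) Φ w| * ‖dx (b i) u w‖ := Finset.sum_le_sum fun i _ => by
            rw [abs_mul]
            refine mul_le_mul_of_nonneg_left ?_ (abs_nonneg _)
            calc |⟪dx (b i) u w, c⟫| ≤ ‖dx (b i) u w‖ * ‖c‖ := abs_real_inner_le_norm _ _
              _ ≤ ‖dx (b i) u w‖ * 1 := mul_le_mul_of_nonneg_left hc (norm_nonneg _)
              _ = ‖dx (b i) u w‖ := mul_one _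
        _ ≤ Real.sqrt (∑ i, |dx (b i) Φ w| ^ 2) * Real.sqrt (∑ i, ‖dx (b i) u w‖ ^ 2) :=
            Real.sum_mul_le_sqrt_mul_sqrt _ _ _
        _ = Real.sqrt (gradSq Φ w) * Real.sqrt (gradSq u w) := by
            simp only [gradSq, Real.norm_eq_abs, hb]
    calc |Φ w * ⟪dt u w + lap u w, c⟫ + (dt Φ w + lap Φ w) * ⟪u w, c⟫ +
          2 * ∑ i, dx (b i) Φ w * ⟪dx (b i) u w, c⟫|
        ≤ |Φ w * ⟪dt u w + lap u w, c⟫| + |(dt Φ w + lap Φ w) * ⟪u w, c⟫| +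
          |2 * ∑ i, dx (b i) Φ w * ⟪dx (b i) u w, c⟫| :=
          (abs_add_le _ _).trans (add_le_add (abs_add_le _ _) le_rfl)
      _ ≤ _ := add_le_add (add_le_add t1 t2) t3
  · -- off `U` the cut-off and its derivatives vanish
    have hw' : w ∉ tsupport Φ := fun h => hw (hΦU h)
    have h0 : Φ w = 0 := image_eq_zero_of_notMem_tsupport hw'
    have hdt0 : dt Φ w = 0 := image_eq_zero_of_notMem_tsupport fun h => hw' (tsupport_dt_subset Φ h)
    have hlap0 : lap Φ w = 0 := image_eq_zero_of_notMem_tsupport fun h => hw' (tsupport_lap_subset Φ h)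
    have hdx0 : ∀ e, dx e Φ w = 0 := fun e =>
      image_eq_zero_of_notMem_tsupport fun h => hw' (tsupport_dx_subset e Φ h)
    have hL : dt (fun z => Φ z • uc z) w + lap (fun z => Φ z • uc z) w = 0 := by
      rw [hsrc, h0, hdt0, hlap0]
      simp only [hdx0, zero_smul, add_zero, Finset.sum_const_zero, smul_zero]
    show |dt (fun z => Φ z • uc z) w + lap (fun z => Φ z • uc z) w| ≤ _
    rw [hL, abs_zero]
    exact hnn

end Source

/-! ### The square of the localised cut-off -/

section Square

variable {Θ : ℝ × E → ℝ}

omit [MeasurableSpace E] [BorelSpace E] in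
/-- Derivatives of the square `Φ = Θ²` of a `C²` function, everywhere:
`∂ₜΦ = 2Θ∂ₜΘ`, `∂ₑΦ = 2Θ∂ₑΘ`, `ΔₓΦ = 2ΘΔₓΘ + 2|∇ₓΘ|²`, `|∇ₓΦ|² = 4Θ²|∇ₓΘ|²`. [folklore] -/
theorem frame_sq (hΘ : ContDiff ℝ 2 Θ) (w : ℝ × E) :
    dt (fun z => Θ z * Θ z) w = 2 * Θ w * dt Θ w ∧
    (∀ e, dx e (fun z => Θ z * Θ z) w = 2 * Θ w * dx e Θ w) ∧
    lap (fun z => Θ z * Θ z) w = 2 * Θ w * lap Θ w + 2 * gradSq Θ w ∧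
    gradSq (fun z => Θ z * Θ z) w = 4 * Θ w ^ 2 * gradSq Θ w := by
  have hfun : (fun z => Θ z * Θ z) = fun z => Θ z • Θ z := rfl
  have hΘ1 : ContDiff ℝ 1 Θ := hΘ.of_le (by norm_num)
  have hd : DifferentiableOn ℝ Θ univ := (hΘ1.differentiable one_ne_zero).differentiableOn
  have hsupp : tsupport Θ ⊆ univ := subset_univ _
  rw [hfun]
  refine ⟨?_, fun e => ?_, ?_, ?_⟩
  · rw [dt_cutoff_smul isOpen_univ hΘ1 hsupp hd w]; simp only [smul_eq_mul]; ring
  · rw [dx_cutoff_smul isOpen_univ hΘ1 hsupp hd e w]; simp only [smul_eq_mul]; ring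
  · rw [lap_cutoff_smul isOpen_univ hΘ hsupp hΘ.contDiffOn w]
    simp only [smul_eq_mul, gradSq, Real.norm_eq_abs, sq_abs, Finset.mul_sum]
    have : ∀ i, dx (stdOrthonormalBasis ℝ E i) Θ w * dx (stdOrthonormalBasis ℝ E i) Θ w =
        dx (stdOrthonormalBasis ℝ E i) Θ w ^ 2 := fun i => by ring
    simp only [this]
    ring
  · rw [gradSq_cutoff_smul isOpen_univ hΘ1 hsupp hd w]
    simp only [smul_eq_mul, gradSq, Real.norm_eq_abs, sq_abs, Finset.mul_sum]
    refine Finset.sum_congr rfl fun i _ => ?_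
    ring

omit [MeasurableSpace E] [BorelSpace E] in
/-- `√(|∇ₓ(Θ²)|²) = 2 |Θ| |∇ₓΘ|`. [folklore] -/
theorem sqrt_gradSq_sq (hΘ : ContDiff ℝ 2 Θ) (w : ℝ × E) :
    Real.sqrt (gradSq (fun z => Θ z * Θ z) w) = 2 * |Θ w| * Real.sqrt (gradSq Θ w) := by
  rw [(frame_sq hΘ w).2.2.2, show (4 : ℝ) * Θ w ^ 2 = (2 * |Θ w|) ^ 2 by rw [mul_pow, sq_abs]; norm_num,
    Real.sqrt_mul (sq_nonneg _), Real.sqrt_sq (by positivity)]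

end Square

/-! ### The majorant of the kernel integrals -/

section Majorant

variable {U : Set (ℝ × E)} {u : ℝ × E → F} {c₁ : ℝ}

/-- **Majorant of `∫ |k| |(∂ₜ + Δ)(Θ² u_c)|`.** Let `u`, `c₁`, `U` be as in
`abs_dt_add_lap_cutoff_smul_inner_le`, `Θ` the localised cut-off of the future cylinder of
`z₀ = (s₀, y₀)` at scale `ρ` with collar `ε` (the properties produced by
`exists_localisedCutoff`, derivative bound `M/ρ²` above `s₀ - ε/3`), `S` a bound for
`‖u‖ + |∇ₓu|` on `C⁺ = [s₀, s₀ + ρ²] × B̄(y₀, ρ)`, and `k` a measurable kernel vanishing for `s ≤ s₀`,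
with `∫_{(s₀, s₀+ρ²] × E} |k| ≤ I` and `|k| ≤ B_k` on the parabolic shell
`{s - s₀ ≥ ρ²/2} ∪ {‖y - y₀‖ ≥ ρ/2}`. Then for `‖c‖ ≤ 1` and `W = Θ² ⟪u, c⟫`,
`∫ |k| |∂ₜW + ΔₓW| ≤ c₁ S I + B_k (6M/ρ²) ∫_{K⁺} ‖u‖ + B_k (4√M/ρ) ∫_{K⁺} |Θ| |∇ₓu|`,
`K⁺ = (s₀, s₀ + ρ²] × B̄(y₀, ρ)`. [folklore] -/
theorem integral_abs_kernel_mul_source_le (hU : IsOpen U) (hu : ContDiffOn ℝ 2 u U)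
    (hc₁ : 0 ≤ c₁)
    (hineq : ∀ z ∈ U, ‖dt u z + lap u z‖ ≤ c₁ * (‖u z‖ + Real.sqrt (gradSq u z)))
    {s₀ : ℝ} {y₀ : E} {ρ ε M : ℝ} (hρ : 0 < ρ) (hε : 0 < ε) (hM : 0 ≤ M)
    (hbox : Icc (s₀ - ε) (s₀ + ρ ^ 2) ×ˢ closedBall y₀ ρ ⊆ U)
    {Θ : ℝ × E → ℝ} (hΘs : ContDiff ℝ ((⊤ : ℕ∞) : WithTop ℕ∞) Θ)
    (hΘsupp : tsupport Θ ⊆ Icc (s₀ - ε) (s₀ + ρ ^ 2) ×ˢ closedBall y₀ ρ)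
    (hΘ01 : ∀ z, 0 ≤ Θ z ∧ Θ z ≤ 1)
    (hΘone : ∀ z : ℝ × E, s₀ - ε / 3 < z.1 → z.1 - s₀ < ρ ^ 2 / 2 → ‖z.2 - y₀‖ < ρ / 2 → Θ z = 1)
    (hΘM : ∀ z : ℝ × E, s₀ - ε / 3 < z.1 →
      |dt Θ z| ≤ M / ρ ^ 2 ∧ gradSq Θ z ≤ M / ρ ^ 2 ∧ |lap Θ z| ≤ M / ρ ^ 2)
    {S : ℝ} (hS : ∀ w ∈ Icc s₀ (s₀ + ρ ^ 2) ×ˢ closedBall y₀ ρ, ‖u w‖ + Real.sqrt (gradSq u w) ≤ S)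
    {k : ℝ × E → ℝ} {I Bk : ℝ} (hk0 : ∀ w : ℝ × E, w.1 ≤ s₀ → k w = 0)
    (hkI : IntegrableOn k (Ioc s₀ (s₀ + ρ ^ 2) ×ˢ (univ : Set E)) volume)
    (hkI' : ∫ w in Ioc s₀ (s₀ + ρ ^ 2) ×ˢ (univ : Set E), |k w| ≤ I) (hBk : 0 ≤ Bk)
    (hkB : ∀ w : ℝ × E, (ρ ^ 2 / 2 ≤ w.1 - s₀ ∨ ρ / 2 ≤ ‖w.2 - y₀‖) → |k w| ≤ Bk)
    {c : F} (hc : ‖c‖ ≤ 1) :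
    ∫ w, |k w| * |dt (fun z => (Θ z * Θ z) • ⟪u z, c⟫) w + lap (fun z => (Θ z * Θ z) • ⟪u z, c⟫) w| ≤
      c₁ * S * I + Bk * (6 * M / ρ ^ 2) * (∫ w in Ioc s₀ (s₀ + ρ ^ 2) ×ˢ closedBall y₀ ρ, ‖u w‖) +
        Bk * (4 * Real.sqrt M / ρ) *
          (∫ w in Ioc s₀ (s₀ + ρ ^ 2) ×ˢ closedBall y₀ ρ, |Θ w| * Real.sqrt (gradSq u w)) := by
  -- notation
  set Φ : ℝ × E → ℝ := fun z => Θ z * Θ z with hΦ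
  set Kp : Set (ℝ × E) := Ioc s₀ (s₀ + ρ ^ 2) ×ˢ closedBall y₀ ρ with hKp
  set Cp : Set (ℝ × E) := Icc s₀ (s₀ + ρ ^ 2) ×ˢ closedBall y₀ ρ with hCp
  set slab : Set (ℝ × E) := Ioc s₀ (s₀ + ρ ^ 2) ×ˢ (univ : Set E) with hslab
  set Fsrc : ℝ × E → ℝ := fun w => dt (fun z => Φ z • ⟪u z, c⟫) w + lap (fun z => Φ z • ⟪u z, c⟫) w
    with hFsrc
  have hρ2 : 0 < ρ ^ 2 := by positivity
  have hΘ2 : ContDiff ℝ 2 Θ := contDiff_two_of_top hΘs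
  have hΦ2 : ContDiff ℝ 2 Φ := hΘ2.mul hΘ2
  have hΦsupp : tsupport Φ ⊆ tsupport Θ := tsupport_mul_subset_left
  have hΦU : tsupport Φ ⊆ U := hΦsupp.trans (hΘsupp.trans hbox)
  have hCpU : Cp ⊆ U := (Set.prod_mono (Icc_subset_Icc (by linarith) le_rfl) Subset.rfl).trans hbox
  have hKpCp : Kp ⊆ Cp := Set.prod_mono Ioc_subset_Icc_self Subset.rfl
  have hCpc : IsCompact Cp := isCompact_Icc.prod (isCompact_closedBall _ _)
  have hKpm : MeasurableSet Kp := measurableSet_Ioc.prod measurableSet_closedBall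
  have hslabm : MeasurableSet slab := measurableSet_Ioc.prod MeasurableSet.univ
  have hS0 : 0 ≤ S := by
    have h := hS (s₀, y₀) ⟨⟨le_rfl, by linarith⟩, mem_closedBall_self hρ.le⟩
    exact le_trans (by positivity) h
  have hΦ1 : ∀ z, |Φ z| ≤ 1 := fun z => by
    rw [hΦ, abs_mul, abs_of_nonneg (hΘ01 z).1]
    exact mul_le_one₀ (hΘ01 z).2 (hΘ01 z).1 (hΘ01 z).2
  -- the source bound
  have hF : ∀ w, |Fsrc w| ≤ |Φ w| * (c₁ * (‖u w‖ + Real.sqrt (gradSq u w))) +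
      |dt Φ w + lap Φ w| * ‖u w‖ + 2 * Real.sqrt (gradSq Φ w) * Real.sqrt (gradSq u w) := fun w =>
    abs_dt_add_lap_cutoff_smul_inner_le hU hu hc₁ hineq hΦ2 hΦU hc w
  -- continuity data for integrability
  obtain ⟨cu, -, -, -⟩ := continuousOn_derivatives hU hu
  obtain ⟨-, cgsu⟩ := continuousOn_lap_gradSq hU hu
  have csq : ContinuousOn (fun w => Real.sqrt (gradSq u w)) U := Real.continuous_sqrt.comp_continuousOn cgsu
  have cΘ : Continuous Θ := hΘs.continuous
  -- the three majorants
  set m₁ : ℝ × E → ℝ := slab.indicator fun w => c₁ * S * |k w| with hm₁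
  set m₂ : ℝ × E → ℝ := Kp.indicator fun w => Bk * (4 * Real.sqrt M / ρ) * (|Θ w| * Real.sqrt (gradSq u w))
    with hm₂
  set m₃ : ℝ × E → ℝ := Kp.indicator fun w => Bk * (6 * M / ρ ^ 2) * ‖u w‖ with hm₃
  have hm₁0 : ∀ w, 0 ≤ m₁ w := fun w => indicator_nonneg (fun w _ => by positivity) w
  have hm₂0 : ∀ w, 0 ≤ m₂ w := fun w =>
    indicator_nonneg (fun w _ => by positivity) w
  have hm₃0 : ∀ w, 0 ≤ m₃ w := fun w => indicator_nonneg (fun w _ => by positivity) w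
  -- pointwise domination
  have hdom : ∀ w, |k w| * |Fsrc w| ≤ m₁ w + m₃ w + m₂ w := by
    intro w
    by_cases h1 : w.1 ≤ s₀
    · rw [hk0 w h1, abs_zero, zero_mul]
      exact add_nonneg (add_nonneg (hm₁0 w) (hm₃0 w)) (hm₂0 w)
    have hlt : s₀ < w.1 := not_le.1 h1
    have hH : s₀ - ε / 3 < w.1 := by linarith
    by_cases h2 : w ∈ tsupport Θ
    · -- `w` lies in `K⁺`, in the slab and in `C⁺`
      have hwbox := hΘsupp h2
      have hwKp : w ∈ Kp := ⟨⟨hlt, hwbox.1.2⟩, hwbox.2⟩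
      have hwslab : w ∈ slab := ⟨⟨hlt, hwbox.1.2⟩, mem_univ _⟩
      have hwS : ‖u w‖ + Real.sqrt (gradSq u w) ≤ S := hS w (hKpCp hwKp)
      have e1 : m₁ w = c₁ * S * |k w| := indicator_of_mem hwslab _
      have e2 : m₂ w = Bk * (4 * Real.sqrt M / ρ) * (|Θ w| * Real.sqrt (gradSq u w)) :=
        indicator_of_mem hwKp _
      have e3 : m₃ w = Bk * (6 * M / ρ ^ 2) * ‖u w‖ := indicator_of_mem hwKp _
      -- the first term
      have T1 : |k w| * (|Φ w| * (c₁ * (‖u w‖ + Real.sqrt (gradSq u w)))) ≤ m₁ w := by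
        rw [e1]
        calc |k w| * (|Φ w| * (c₁ * (‖u w‖ + Real.sqrt (gradSq u w))))
            ≤ |k w| * (1 * (c₁ * S)) := by
              refine mul_le_mul_of_nonneg_left ?_ (abs_nonneg _)
              exact mul_le_mul (hΦ1 w) (mul_le_mul_of_nonneg_left hwS hc₁) (by positivity) zero_le_one
          _ = c₁ * S * |k w| := by ring
      by_cases h3 : w.1 - s₀ < ρ ^ 2 / 2 ∧ ‖w.2 - y₀‖ < ρ / 2
      · -- the inner region: `Φ = 1` near `w`
        set O : Set (ℝ × E) := {z | s₀ - ε / 3 < z.1 ∧ z.1 - s₀ < ρ ^ 2 / 2 ∧ ‖z.2 - y₀‖ < ρ / 2} with hO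
        have hOo : IsOpen O :=
          (isOpen_lt continuous_const continuous_fst).inter
            ((isOpen_lt (continuous_fst.sub continuous_const) continuous_const).inter
              (isOpen_lt (continuous_snd.sub continuous_const).norm continuous_const))
        have hwO : w ∈ O := ⟨hH, h3.1, h3.2⟩
        have hΦO : EqOn Φ (fun _ => (1 : ℝ)) O := fun z hz => by
          show Θ z * Θ z = 1
          rw [hΘone z hz.1 hz.2.1 hz.2.2, one_mul]
        obtain ⟨hdt0, hlap0, hgs0⟩ := dt_lap_gradSq_eq_zero_of_eqOn_const hOo hΦO hwO
        have hF' : |Fsrc w| ≤ |Φ w| * (c₁ * (‖u w‖ + Real.sqrt (gradSq u w))) := by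
          have h := hF w
          simp only [hdt0, hlap0, hgs0, add_zero, abs_zero, zero_mul, Real.sqrt_zero, mul_zero] at h
          exact h
        calc |k w| * |Fsrc w| ≤ |k w| * (|Φ w| * (c₁ * (‖u w‖ + Real.sqrt (gradSq u w)))) :=
              mul_le_mul_of_nonneg_left hF' (abs_nonneg _)
          _ ≤ m₁ w := T1
          _ ≤ m₁ w + m₃ w + m₂ w := by linarith [hm₂0 w, hm₃0 w]
      · -- the shell: the kernel is bounded by `Bk`
        have hkw : |k w| ≤ Bk := hkB w (by
          rcases not_and_or.1 h3 with h | h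
          · exact Or.inl (not_lt.1 h)
          · exact Or.inr (not_lt.1 h))
        obtain ⟨bdt, bgs, blap⟩ := hΘM w hH
        obtain ⟨fdt, -, flap, -⟩ := frame_sq hΘ2 w
        have hΘw : |Θ w| ≤ 1 := by rw [abs_of_nonneg (hΘ01 w).1]; exact (hΘ01 w).2
        have hsrc2 : |dt Φ w + lap Φ w| ≤ 6 * M / ρ ^ 2 := by
          rw [fdt, flap]
          have hg0 : 0 ≤ gradSq Θ w := gradSq_nonneg _ _
          calc |2 * Θ w * dt Θ w + (2 * Θ w * lap Θ w + 2 * gradSq Θ w)|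
              ≤ |2 * Θ w * dt Θ w| + (|2 * Θ w * lap Θ w| + |2 * gradSq Θ w|) :=
                (abs_add_le _ _).trans (add_le_add le_rfl (abs_add_le _ _))
            _ ≤ 2 * (M / ρ ^ 2) + (2 * (M / ρ ^ 2) + 2 * (M / ρ ^ 2)) := by
                gcongr
                · rw [abs_mul, abs_mul, abs_two]
                  calc 2 * |Θ w| * |dt Θ w| ≤ 2 * 1 * (M / ρ ^ 2) := by gcongr
                    _ = 2 * (M / ρ ^ 2) := by ring
                · rw [abs_mul, abs_mul, abs_two]
                  calc 2 * |Θ w| * |lap Θ w| ≤ 2 * 1 * (M / ρ ^ 2) := by gcongr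
                    _ = 2 * (M / ρ ^ 2) := by ring
                · rw [abs_mul, abs_two, abs_of_nonneg hg0]
                  gcongr
            _ = 6 * M / ρ ^ 2 := by ring
        have hsrc3 : 2 * Real.sqrt (gradSq Φ w) ≤ 4 * |Θ w| * (Real.sqrt M / ρ) := by
          rw [sqrt_gradSq_sq hΘ2 w]
          have : Real.sqrt (gradSq Θ w) ≤ Real.sqrt M / ρ := by
            rw [← Real.sqrt_sq hρ.le, ← Real.sqrt_div' M (sq_nonneg ρ)]
            exact Real.sqrt_le_sqrt bgs
          calc 2 * (2 * |Θ w| * Real.sqrt (gradSq Θ w)) = 4 * |Θ w| * Real.sqrt (gradSq Θ w) := by ring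
            _ ≤ 4 * |Θ w| * (Real.sqrt M / ρ) := by gcongr
        have T3 : |k w| * (|dt Φ w + lap Φ w| * ‖u w‖) ≤ m₃ w := by
          rw [e3]
          calc |k w| * (|dt Φ w + lap Φ w| * ‖u w‖) ≤ Bk * (6 * M / ρ ^ 2 * ‖u w‖) :=
                mul_le_mul hkw (mul_le_mul_of_nonneg_right hsrc2 (norm_nonneg _)) (by positivity) hBk
            _ = Bk * (6 * M / ρ ^ 2) * ‖u w‖ := by ring
        have T2 : |k w| * (2 * Real.sqrt (gradSq Φ w) * Real.sqrt (gradSq u w)) ≤ m₂ w := by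
          rw [e2]
          calc |k w| * (2 * Real.sqrt (gradSq Φ w) * Real.sqrt (gradSq u w))
              ≤ Bk * (4 * |Θ w| * (Real.sqrt M / ρ) * Real.sqrt (gradSq u w)) :=
                mul_le_mul hkw (mul_le_mul_of_nonneg_right hsrc3 (Real.sqrt_nonneg _))
                  (by positivity) hBk
            _ = Bk * (4 * Real.sqrt M / ρ) * (|Θ w| * Real.sqrt (gradSq u w)) := by ring
        calc |k w| * |Fsrc w|
            ≤ |k w| * (|Φ w| * (c₁ * (‖u w‖ + Real.sqrt (gradSq u w))) +
                |dt Φ w + lap Φ w| * ‖u w‖ + 2 * Real.sqrt (gradSq Φ w) * Real.sqrt (gradSq u w)) :=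
              mul_le_mul_of_nonneg_left (hF w) (abs_nonneg _)
          _ = |k w| * (|Φ w| * (c₁ * (‖u w‖ + Real.sqrt (gradSq u w)))) +
                |k w| * (|dt Φ w + lap Φ w| * ‖u w‖) +
                |k w| * (2 * Real.sqrt (gradSq Φ w) * Real.sqrt (gradSq u w)) := by ring
          _ ≤ m₁ w + m₃ w + m₂ w := add_le_add (add_le_add T1 T3) T2
    · -- off the support of `Θ` the source vanishes
      have h2' : w ∉ tsupport Φ := fun h => h2 (hΦsupp h)
      have hΦ0 : Φ w = 0 := image_eq_zero_of_notMem_tsupport h2'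
      have hdt0 : dt Φ w = 0 := image_eq_zero_of_notMem_tsupport fun h => h2' (tsupport_dt_subset Φ h)
      have hlap0 : lap Φ w = 0 :=
        image_eq_zero_of_notMem_tsupport fun h => h2' (tsupport_lap_subset Φ h)
      have hgs0 : gradSq Φ w = 0 := gradSq_eq_zero_of_notMem_tsupport h2'
      have hF0 : |Fsrc w| ≤ 0 := by
        have h := hF w
        simp only [hΦ0, hdt0, hlap0, hgs0, abs_zero, zero_mul, add_zero, Real.sqrt_zero, mul_zero] at h
        exact h
      calc |k w| * |Fsrc w| ≤ |k w| * 0 := mul_le_mul_of_nonneg_left hF0 (abs_nonneg _)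
        _ = 0 := mul_zero _
        _ ≤ m₁ w + m₃ w + m₂ w := add_nonneg (add_nonneg (hm₁0 w) (hm₃0 w)) (hm₂0 w)
  -- integrability of the majorants
  have Im₁ : Integrable m₁ (volume : Measure (ℝ × E)) :=
    IntegrableOn.integrable_indicator (hkI.norm.const_mul (c₁ * S)) hslabm
  have Iu : IntegrableOn (fun w => ‖u w‖) Kp volume :=
    ((cu.norm.mono hCpU).integrableOn_compact hCpc).mono_set hKpCp
  have IΘ : IntegrableOn (fun w => |Θ w| * Real.sqrt (gradSq u w)) Kp volume :=
    (((cΘ.continuousOn.abs).mul (csq.mono hCpU)).integrableOn_compact hCpc).mono_set hKpCp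
  have Im₂ : Integrable m₂ (volume : Measure (ℝ × E)) :=
    IntegrableOn.integrable_indicator (IΘ.const_mul (Bk * (4 * Real.sqrt M / ρ))) hKpm
  have Im₃ : Integrable m₃ (volume : Measure (ℝ × E)) :=
    IntegrableOn.integrable_indicator (Iu.const_mul (Bk * (6 * M / ρ ^ 2))) hKpm
  have I13 : Integrable (fun w => m₁ w + m₃ w) (volume : Measure (ℝ × E)) := Im₁.add Im₃
  have I132 : Integrable (fun w => m₁ w + m₃ w + m₂ w) (volume : Measure (ℝ × E)) := I13.add Im₂
  -- integrate
  have hint : ∫ w, |k w| * |Fsrc w| ≤ ∫ w, (m₁ w + m₃ w + m₂ w) :=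
    integral_mono_of_nonneg (Eventually.of_forall fun w => mul_nonneg (abs_nonneg _) (abs_nonneg _))
      I132 (Eventually.of_forall hdom)
  rw [integral_add I13 Im₂, integral_add Im₁ Im₃] at hint
  have v1 : ∫ w, m₁ w ≤ c₁ * S * I := by
    rw [hm₁, integral_indicator hslabm, integral_const_mul]
    exact mul_le_mul_of_nonneg_left hkI' (mul_nonneg hc₁ hS0)
  have v2 : ∫ w, m₂ w = Bk * (4 * Real.sqrt M / ρ) * ∫ w in Kp, |Θ w| * Real.sqrt (gradSq u w) := by
    rw [hm₂, integral_indicator hKpm, integral_const_mul]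
  have v3 : ∫ w, m₃ w = Bk * (6 * M / ρ ^ 2) * ∫ w in Kp, ‖u w‖ := by
    rw [hm₃, integral_indicator hKpm, integral_const_mul]
  rw [v2, v3] at hint
  change ∫ w, |k w| * |Fsrc w| ≤ _
  linarith

end Majorant

/-! ### Caccioppoli's inequality on the future cylinder -/

section CaccioppoliApplied

variable {U : Set (ℝ × E)} {u : ℝ × E → F} {c₁ : ℝ}

/-- **Gradient control on the future cylinder.** With `Θ` the localised cut-off (collar `ε`,
scale `ρ`, derivative bound `M/ρ²` above `s₀ - ε/3`):
`∫_{K⁺} Θ² |∇ₓu|² ≤ 4 ((c₁ + 2c₁²) + 11 M/ρ²) ∫_{[s₀-ε, s₀+ρ²] × B̄(y₀, ρ)} ‖u‖²`,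
`K⁺ = (s₀, s₀ + ρ²] × B̄(y₀, ρ)` (Caccioppoli's inequality `integral_mul_sq_mul_gradSq_le` with the
cut-off `Θ` and a monotone time weight equal to `0` below `s₀ - ε/3` and to `1` above `s₀`).
[folklore] -/
theorem setIntegral_sq_mul_gradSq_le (hU : IsOpen U) (hu : ContDiffOn ℝ 2 u U) (hc₁ : 0 ≤ c₁)
    (hineq : ∀ z ∈ U, ‖dt u z + lap u z‖ ≤ c₁ * (‖u z‖ + Real.sqrt (gradSq u z)))
    {s₀ : ℝ} {y₀ : E} {ρ ε M : ℝ} (hρ : 0 < ρ) (hε : 0 < ε) (hM : 0 ≤ M)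
    (hbox : Icc (s₀ - ε) (s₀ + ρ ^ 2) ×ˢ closedBall y₀ ρ ⊆ U)
    {Θ : ℝ × E → ℝ} (hΘs : ContDiff ℝ ((⊤ : ℕ∞) : WithTop ℕ∞) Θ) (hΘc : HasCompactSupport Θ)
    (hΘsupp : tsupport Θ ⊆ Icc (s₀ - ε) (s₀ + ρ ^ 2) ×ˢ closedBall y₀ ρ)
    (hΘ01 : ∀ z, 0 ≤ Θ z ∧ Θ z ≤ 1)
    (hΘM : ∀ z : ℝ × E, s₀ - ε / 3 < z.1 →
      |dt Θ z| ≤ M / ρ ^ 2 ∧ gradSq Θ z ≤ M / ρ ^ 2 ∧ |lap Θ z| ≤ M / ρ ^ 2) :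
    ∫ w in Ioc s₀ (s₀ + ρ ^ 2) ×ˢ closedBall y₀ ρ, Θ w ^ 2 * gradSq u w ≤
      4 * ((c₁ + 2 * c₁ ^ 2) + 11 * M / ρ ^ 2) *
        ∫ w in Icc (s₀ - ε) (s₀ + ρ ^ 2) ×ˢ closedBall y₀ ρ, ‖u w‖ ^ 2 := by
  set Kp : Set (ℝ × E) := Ioc s₀ (s₀ + ρ ^ 2) ×ˢ closedBall y₀ ρ with hKp
  set box : Set (ℝ × E) := Icc (s₀ - ε) (s₀ + ρ ^ 2) ×ˢ closedBall y₀ ρ with hboxdef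
  have hρ2 : 0 < ρ ^ 2 := by positivity
  have hΘ2 : ContDiff ℝ 2 Θ := contDiff_two_of_top hΘs
  have hΘU : tsupport Θ ⊆ U := hΘsupp.trans hbox
  have hΘabs : ∀ z, |Θ z| ≤ 1 := fun z => by rw [abs_of_nonneg (hΘ01 z).1]; exact (hΘ01 z).2
  obtain ⟨g, hgs, hg01, hg0, hg1, -, hg'⟩ := exists_smooth_monotone_transition
    (a := s₀ - ε / 3) (b := s₀) (by linarith)
  have hgC1 : ContDiff ℝ 1 g := hgs.of_le (by exact_mod_cast le_top)
  have hC := integral_mul_sq_mul_gradSq_le hU hu hc₁ hineq hΘ2 hΘc hΘU hΘabs hgC1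
    (fun s => (hg01 s).1) hg'
  have hboxc : IsCompact box := isCompact_Icc.prod (isCompact_closedBall _ _)
  have hKpbox : Kp ⊆ box := Set.prod_mono (Ioc_subset_Icc_self.trans (Icc_subset_Icc (by linarith) le_rfl))
    Subset.rfl
  have hKpm : MeasurableSet Kp := measurableSet_Ioc.prod measurableSet_closedBall
  have hboxm : MeasurableSet box := measurableSet_Icc.prod measurableSet_closedBall
  -- continuity data
  obtain ⟨cu, -, -, -⟩ := continuousOn_derivatives hU hu
  obtain ⟨-, cgsu⟩ := continuousOn_lap_gradSq hU hu
  have cg : Continuous fun z : ℝ × E => g z.1 := (contDiff_comp_fst (E := E) hgC1).continuous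
  have cΘ : Continuous Θ := hΘs.continuous
  have cdtΘ : Continuous (dt Θ) := continuous_dt_of_contDiff_two hΘ2
  have clapΘ : Continuous (lap Θ) := continuous_lap_of_contDiff_two hΘ2
  have cgsΘ : Continuous (gradSq Θ) := by
    change Continuous fun z => ∑ i, ‖dx (stdOrthonormalBasis ℝ E i) Θ z‖ ^ 2
    exact continuous_finsetSum _ fun i _ => ((continuous_dx_of_contDiff_two hΘ2 _).norm).pow 2
  have hΘ0 : ∀ z ∉ tsupport Θ, Θ z = 0 := fun z hz => image_eq_zero_of_notMem_tsupport hz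
  have hgsΘ0 : ∀ z ∉ tsupport Θ, gradSq Θ z = 0 := fun z hz => gradSq_eq_zero_of_notMem_tsupport hz
  have hdtΘ0 : ∀ z ∉ tsupport Θ, dt Θ z = 0 := fun z hz =>
    image_eq_zero_of_notMem_tsupport fun h => hz (tsupport_dt_subset Θ h)
  have hlapΘ0 : ∀ z ∉ tsupport Θ, lap Θ z = 0 := fun z hz =>
    image_eq_zero_of_notMem_tsupport fun h => hz (tsupport_lap_subset Θ h)
  -- lower bound: `∫_{K⁺} Θ² |∇u|² ≤ ∫ g Θ² |∇u|²`
  have Iq : Integrable (fun z => g z.1 * (Θ z ^ 2 * gradSq u z)) (volume : Measure (ℝ × E)) :=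
    integrable_of_continuousOn_of_eq_zero_off_tsupport hU
      (cg.continuousOn.mul ((cΘ.pow 2).continuousOn.mul cgsu)) hΘc hΘU (fun z hz => by simp [hΘ0 z hz])
  have IKp : IntegrableOn (fun z => Θ z ^ 2 * gradSq u z) Kp volume :=
    ((((cΘ.pow 2).continuousOn).mul (cgsu.mono hbox)).integrableOn_compact hboxc).mono_set hKpbox
  have hlow : ∫ w in Kp, Θ w ^ 2 * gradSq u w ≤ ∫ z, g z.1 * (Θ z ^ 2 * gradSq u z) := by
    rw [← integral_indicator hKpm]
    refine integral_mono (IKp.integrable_indicator hKpm) Iq fun w => ?_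
    by_cases hw : w ∈ Kp
    · rw [indicator_of_mem hw, hg1 _ (le_of_lt hw.1.1), one_mul]
    · rw [indicator_of_notMem hw]
      exact mul_nonneg (hg01 _).1 (mul_nonneg (sq_nonneg _) (gradSq_nonneg _ _))
  -- upper bound for the right-hand side of Caccioppoli
  set A : ℝ := (c₁ + 2 * c₁ ^ 2) + 11 * M / ρ ^ 2 with hA
  have hA0 : 0 ≤ A := by rw [hA]; positivity
  have IA : Integrable (fun z => g z.1 * (((c₁ + 2 * c₁ ^ 2) * Θ z ^ 2 + 9 * gradSq Θ z +
      |dt Θ z + lap Θ z|) * ‖u z‖ ^ 2)) (volume : Measure (ℝ × E)) :=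
    integrable_of_continuousOn_of_eq_zero_off_tsupport hU
      (cg.continuousOn.mul ((((continuous_const.mul (cΘ.pow 2)).add
        (continuous_const.mul cgsΘ)).add (cdtΘ.add clapΘ).abs).continuousOn.mul (cu.norm.pow 2)))
      hΘc hΘU (fun z hz => by
        rw [hΘ0 z hz, hgsΘ0 z hz, hdtΘ0 z hz, hlapΘ0 z hz]
        norm_num)
  have Ibox : IntegrableOn (fun z => A * ‖u z‖ ^ 2) box volume :=
    ((cu.norm.pow 2).mono hbox).integrableOn_compact hboxc |>.const_mul A
  have hup : ∫ z, g z.1 * (((c₁ + 2 * c₁ ^ 2) * Θ z ^ 2 + 9 * gradSq Θ z + |dt Θ z + lap Θ z|) *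
      ‖u z‖ ^ 2) ≤ ∫ z in box, A * ‖u z‖ ^ 2 := by
    rw [← integral_indicator hboxm]
    refine integral_mono IA (Ibox.integrable_indicator hboxm) fun w => ?_
    by_cases hgw : g w.1 = 0
    · rw [hgw, zero_mul]
      exact indicator_nonneg (fun z _ => mul_nonneg hA0 (sq_nonneg _)) w
    have hw1 : s₀ - ε / 3 < w.1 := by
      by_contra h
      exact hgw (hg0 _ (not_lt.1 h))
    by_cases hwΘ : w ∈ tsupport Θ
    · rw [indicator_of_mem (hΘsupp hwΘ)]
      obtain ⟨bdt, bgs, blap⟩ := hΘM w hw1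
      have hΘsq : Θ w ^ 2 ≤ 1 := pow_le_one₀ (hΘ01 w).1 (hΘ01 w).2
      have hcoef : (c₁ + 2 * c₁ ^ 2) * Θ w ^ 2 + 9 * gradSq Θ w + |dt Θ w + lap Θ w| ≤ A := by
        have h1 : (c₁ + 2 * c₁ ^ 2) * Θ w ^ 2 ≤ c₁ + 2 * c₁ ^ 2 :=
          mul_le_of_le_one_right (by positivity) hΘsq
        have h2 : |dt Θ w + lap Θ w| ≤ M / ρ ^ 2 + M / ρ ^ 2 := (abs_add_le _ _).trans (add_le_add bdt blap)
        rw [hA]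
        have : 9 * gradSq Θ w ≤ 9 * (M / ρ ^ 2) := by gcongr
        have e : 11 * M / ρ ^ 2 = 9 * (M / ρ ^ 2) + (M / ρ ^ 2 + M / ρ ^ 2) := by ring
        linarith
      calc g w.1 * (((c₁ + 2 * c₁ ^ 2) * Θ w ^ 2 + 9 * gradSq Θ w + |dt Θ w + lap Θ w|) * ‖u w‖ ^ 2)
          ≤ 1 * (A * ‖u w‖ ^ 2) := by
            refine mul_le_mul (hg01 _).2 (mul_le_mul_of_nonneg_right hcoef (sq_nonneg _)) ?_ zero_le_one
            exact mul_nonneg (add_nonneg (add_nonneg (mul_nonneg (by positivity) (sq_nonneg _))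
              (mul_nonneg (by norm_num) (gradSq_nonneg _ _))) (abs_nonneg _)) (sq_nonneg _)
        _ = A * ‖u w‖ ^ 2 := one_mul _
    · rw [hΘ0 w hwΘ, hgsΘ0 w hwΘ, hdtΘ0 w hwΘ, hlapΘ0 w hwΘ]
      norm_num
      exact indicator_nonneg (fun z _ => mul_nonneg hA0 (sq_nonneg _)) w
  calc ∫ w in Kp, Θ w ^ 2 * gradSq u w ≤ ∫ z, g z.1 * (Θ z ^ 2 * gradSq u z) := hlow
    _ ≤ 4 * ∫ z, g z.1 * (((c₁ + 2 * c₁ ^ 2) * Θ z ^ 2 + 9 * gradSq Θ z + |dt Θ z + lap Θ z|) *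
        ‖u z‖ ^ 2) := hC
    _ ≤ 4 * ∫ z in box, A * ‖u z‖ ^ 2 := by linarith
    _ = 4 * A * ∫ z in box, ‖u z‖ ^ 2 := by rw [integral_const_mul]; ring

end CaccioppoliApplied

/-! ### The representation step: bounds for one component -/

section Component

variable {U : Set (ℝ × E)} {u : ℝ × E → F} {c₁ : ℝ}

/-- **Bounds for one component at the base point.** In the setting of
`integral_abs_kernel_mul_source_le`, with `B` the shell constant of `exists_shell_bound` and
`Θ = 1` near `z₀ = (s₀, y₀)`, the representation formulas give, for `‖c‖ ≤ 1`,
`|⟪u(z₀), c⟫| ≤ c₁ S ρ² + R` and `|⟪∂ᵥu(z₀), c⟫| ≤ c₁ S 2^{d/2} ‖v‖ 2ρ + R` (`‖v‖ ≤ 1`), where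
`R = (B/ρ^{d+1}) ((6M/ρ²) ∫_{K⁺} ‖u‖ + (4√M/ρ) ∫_{K⁺} |Θ| |∇ₓu|)`. [folklore] -/
theorem component_bounds (hU : IsOpen U) (hu : ContDiffOn ℝ 2 u U) (hc₁ : 0 ≤ c₁)
    (hineq : ∀ z ∈ U, ‖dt u z + lap u z‖ ≤ c₁ * (‖u z‖ + Real.sqrt (gradSq u z)))
    {s₀ : ℝ} {y₀ : E} {ρ ε M B : ℝ} (hρ : 0 < ρ) (hε : 0 < ε) (hM : 0 ≤ M)
    (hB : 0 < B)
    (hshell : ∀ (s₀ : ℝ) (y₀ v : E), ‖v‖ ≤ 1 → ∀ w : ℝ × E,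
      (ρ ^ 2 / 2 ≤ w.1 - s₀ ∨ ρ / 2 ≤ ‖w.2 - y₀‖) →
        |backKernel (UnboundedOperators.heatKernel (E := E)) (s₀ - w.1, w.2 - y₀)| ≤
            B / ρ ^ (Module.finrank ℝ E + 1) ∧
          |backKernel (heatKernelGrad v) (s₀ - w.1, w.2 - y₀)| ≤ B / ρ ^ (Module.finrank ℝ E + 1))
    (hbox : Icc (s₀ - ε) (s₀ + ρ ^ 2) ×ˢ closedBall y₀ ρ ⊆ U)
    {Θ : ℝ × E → ℝ} (hΘs : ContDiff ℝ ((⊤ : ℕ∞) : WithTop ℕ∞) Θ) (hΘc : HasCompactSupport Θ)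
    (hΘsupp : tsupport Θ ⊆ Icc (s₀ - ε) (s₀ + ρ ^ 2) ×ˢ closedBall y₀ ρ)
    (hΘ01 : ∀ z, 0 ≤ Θ z ∧ Θ z ≤ 1)
    (hΘone : ∀ z : ℝ × E, s₀ - ε / 3 < z.1 → z.1 - s₀ < ρ ^ 2 / 2 → ‖z.2 - y₀‖ < ρ / 2 → Θ z = 1)
    (hΘM : ∀ z : ℝ × E, s₀ - ε / 3 < z.1 →
      |dt Θ z| ≤ M / ρ ^ 2 ∧ gradSq Θ z ≤ M / ρ ^ 2 ∧ |lap Θ z| ≤ M / ρ ^ 2)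
    {S : ℝ} (hS : ∀ w ∈ Icc s₀ (s₀ + ρ ^ 2) ×ˢ closedBall y₀ ρ, ‖u w‖ + Real.sqrt (gradSq u w) ≤ S)
    {c : F} (hc : ‖c‖ ≤ 1) :
    |⟪u (s₀, y₀), c⟫| ≤ c₁ * S * ρ ^ 2 +
        (B / ρ ^ (Module.finrank ℝ E + 1) * (6 * M / ρ ^ 2) *
            (∫ w in Ioc s₀ (s₀ + ρ ^ 2) ×ˢ closedBall y₀ ρ, ‖u w‖) +
          B / ρ ^ (Module.finrank ℝ E + 1) * (4 * Real.sqrt M / ρ) *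
            (∫ w in Ioc s₀ (s₀ + ρ ^ 2) ×ˢ closedBall y₀ ρ, |Θ w| * Real.sqrt (gradSq u w))) ∧
      ∀ v : E, ‖v‖ ≤ 1 →
        |⟪dx v u (s₀, y₀), c⟫| ≤
          c₁ * S * ((2 : ℝ) ^ ((Module.finrank ℝ E : ℝ) / 2) * ‖v‖ * (2 * ρ)) +
            (B / ρ ^ (Module.finrank ℝ E + 1) * (6 * M / ρ ^ 2) *
                (∫ w in Ioc s₀ (s₀ + ρ ^ 2) ×ˢ closedBall y₀ ρ, ‖u w‖) +
              B / ρ ^ (Module.finrank ℝ E + 1) * (4 * Real.sqrt M / ρ) *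
                (∫ w in Ioc s₀ (s₀ + ρ ^ 2) ×ˢ closedBall y₀ ρ, |Θ w| * Real.sqrt (gradSq u w))) := by
  set d : ℕ := Module.finrank ℝ E with hd
  set Φ : ℝ × E → ℝ := fun z => Θ z * Θ z with hΦ
  set uc : ℝ × E → ℝ := fun z => ⟪u z, c⟫ with huc
  set W : ℝ × E → ℝ := fun z => Φ z • uc z with hW
  have hρ2 : 0 < ρ ^ 2 := by positivity
  have hΘ2 : ContDiff ℝ 2 Θ := contDiff_two_of_top hΘs
  have hΦ2 : ContDiff ℝ 2 Φ := hΘ2.mul hΘ2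
  have hΦ1 : ContDiff ℝ 1 Φ := hΦ2.of_le (by norm_num)
  have hΦc : HasCompactSupport Φ := hΘc.mul_left
  have hΦsupp : tsupport Φ ⊆ tsupport Θ := tsupport_mul_subset_left
  have hΦU : tsupport Φ ⊆ U := hΦsupp.trans (hΘsupp.trans hbox)
  have hucU : ContDiffOn ℝ 2 uc U := contDiffOn_inner_const hu
  have hucd : DifferentiableOn ℝ uc U := hucU.differentiableOn (by norm_num)
  have hW2 : ContDiff ℝ 2 W := contDiff_cutoff_smul hU hΦ2 hΦU hucU
  have hWc : HasCompactSupport W := hasCompactSupport_cutoff_smul hΦc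
  have hBρ : 0 ≤ B / ρ ^ (d + 1) := by positivity
  -- the base point
  have hz₀U : (s₀, y₀) ∈ U := hbox ⟨⟨by linarith, by linarith⟩, mem_closedBall_self hρ.le⟩
  have hud : DifferentiableAt ℝ u (s₀, y₀) :=
    (hu.differentiableOn (by norm_num)).differentiableAt (hU.mem_nhds hz₀U)
  -- `Θ = 1` near the base point
  set O : Set (ℝ × E) := {z | s₀ - ε / 3 < z.1 ∧ z.1 - s₀ < ρ ^ 2 / 2 ∧ ‖z.2 - y₀‖ < ρ / 2} with hO
  have hOo : IsOpen O :=
    (isOpen_lt continuous_const continuous_fst).inter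
      ((isOpen_lt (continuous_fst.sub continuous_const) continuous_const).inter
        (isOpen_lt (continuous_snd.sub continuous_const).norm continuous_const))
  have hz₀O : (s₀, y₀) ∈ O := ⟨by show s₀ - ε / 3 < s₀; linarith, by show s₀ - s₀ < ρ ^ 2 / 2; simp [hρ2],
    by show ‖y₀ - y₀‖ < ρ / 2; simp [hρ]⟩
  have hΘev : Θ =ᶠ[𝓝 (s₀, y₀)] fun _ => (1 : ℝ) := by
    filter_upwards [hOo.mem_nhds hz₀O] with z hz
    exact hΘone z hz.1 hz.2.1 hz.2.2
  have hΘz₀ : Θ (s₀, y₀) = 1 := hΘev.self_of_nhds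
  have hΦz₀ : Φ (s₀, y₀) = 1 := by show Θ (s₀, y₀) * Θ (s₀, y₀) = 1; rw [hΘz₀, one_mul]
  have hdxΦz₀ : ∀ v, dx v Φ (s₀, y₀) = 0 := fun v => by
    rw [(frame_sq hΘ2 (s₀, y₀)).2.1 v, dx_eq_zero_of_eventuallyEq_const hΘev, mul_zero]
  -- the majorant for a kernel
  have hmaj := fun (k : ℝ × E → ℝ) (I Bk : ℝ)
      (hk0 : ∀ w : ℝ × E, w.1 ≤ s₀ → k w = 0)
      (hkI : IntegrableOn k (Ioc s₀ (s₀ + ρ ^ 2) ×ˢ (univ : Set E)) volume)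
      (hkI' : ∫ w in Ioc s₀ (s₀ + ρ ^ 2) ×ˢ (univ : Set E), |k w| ≤ I) (hBk : 0 ≤ Bk)
      (hkB : ∀ w : ℝ × E, (ρ ^ 2 / 2 ≤ w.1 - s₀ ∨ ρ / 2 ≤ ‖w.2 - y₀‖) → |k w| ≤ Bk) =>
    integral_abs_kernel_mul_source_le hU hu hc₁ hineq hρ hε hM hbox hΘs hΘsupp hΘ01 hΘone hΘM hS
      hk0 hkI hkI' hBk hkB hc
  -- `|∫ k F| ≤ ∫ |k| |F|`
  have habs : ∀ k : ℝ × E → ℝ, |∫ w, k w * (dt W w + lap W w)| ≤ ∫ w, |k w| * |dt W w + lap W w| := by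
    intro k
    refine (abs_integral_le_integral_abs (μ := volume)).trans (le_of_eq ?_)
    refine integral_congr_ae (Eventually.of_forall fun w => ?_)
    exact abs_mul _ _
  constructor
  · -- the value
    have hrep := eq_neg_integral_backKernel_mul_dt_add_lap hW2 hWc (s₀, y₀)
    have hWz₀ : W (s₀, y₀) = ⟪u (s₀, y₀), c⟫ := by
      show Φ (s₀, y₀) • ⟪u (s₀, y₀), c⟫ = _
      rw [hΦz₀, one_smul]
    have hkI' : ∫ w in Ioc s₀ (s₀ + ρ ^ 2) ×ˢ (univ : Set E),
        |backKernel (UnboundedOperators.heatKernel (E := E)) (s₀ - w.1, w.2 - y₀)| ≤ ρ ^ 2 := by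
      rw [show (fun w : ℝ × E => |backKernel (UnboundedOperators.heatKernel (E := E)) (s₀ - w.1, w.2 - y₀)|) =
          fun w => backKernel (UnboundedOperators.heatKernel (E := E)) (s₀ - w.1, w.2 - y₀) from
        funext fun w => abs_of_nonneg (backKernel_heatKernel_shift_nonneg s₀ y₀ w),
        setIntegral_slab_backKernel_heatKernel_shift s₀ y₀ hρ2.le]
    have hm := hmaj _ (ρ ^ 2) (B / ρ ^ (d + 1))
      (fun w hw => backKernel_shift_eq_zero_of_le _ s₀ y₀ hw)
      (integrableOn_slab_backKernel_heatKernel_shift s₀ y₀ (ρ ^ 2)) hkI' hBρ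
      (fun w hw => (hshell s₀ y₀ 0 (by simp) w hw).1)
    rw [← hWz₀, hrep, abs_neg]
    have h := (habs _).trans hm
    linarith
  · -- the gradient components
    intro v hv
    have hrep := dx_eq_integral_backKernel_mul_dt_add_lap hW2 hWc v (s₀, y₀)
    have hWz₀ : dx v W (s₀, y₀) = ⟪dx v u (s₀, y₀), c⟫ := by
      rw [hW, dx_cutoff_smul hU hΦ1 hΦU hucd v (s₀, y₀), hΦz₀, hdxΦz₀, one_smul, zero_smul, add_zero,
        huc, dx_inner_const hud]
    have hkI' : ∫ w in Ioc s₀ (s₀ + ρ ^ 2) ×ˢ (univ : Set E),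
        |backKernel (heatKernelGrad v) (s₀ - w.1, w.2 - y₀)| ≤
        (2 : ℝ) ^ ((d : ℝ) / 2) * ‖v‖ * (2 * ρ) := by
      have h := setIntegral_slab_abs_backKernel_heatKernelGrad_shift_le v s₀ y₀ hρ2.le
      rwa [Real.sqrt_sq hρ.le] at h
    have hm := hmaj _ ((2 : ℝ) ^ ((d : ℝ) / 2) * ‖v‖ * (2 * ρ)) (B / ρ ^ (d + 1))
      (fun w hw => backKernel_shift_eq_zero_of_le _ s₀ y₀ hw)
      (integrableOn_slab_backKernel_heatKernelGrad_shift v s₀ y₀ hρ2.le) hkI' hBρ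
      (fun w hw => (hshell s₀ y₀ v hv w hw).2)
    rw [← hWz₀, hrep]
    have h := (habs _).trans hm
    linarith

end Component

/-! ### The pointwise estimate -/

section Assembly

omit [MeasurableSpace E] [BorelSpace E] in
/-- `√(gradSq)` is controlled by a common bound for the frame components:
if `‖∂ᵢu(z)‖ ≤ R` for all `i` then `|∇ₓu(z)| ≤ √d R`. [folklore] -/
theorem sqrt_gradSq_le_of_forall_le {G : Type*} [NormedAddCommGroup G] [NormedSpace ℝ G]
    {V : ℝ × E → G} {z : ℝ × E} {R : ℝ} (hR : 0 ≤ R)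
    (h : ∀ i, ‖dx (stdOrthonormalBasis ℝ E i) V z‖ ≤ R) :
    Real.sqrt (gradSq V z) ≤ Real.sqrt (Module.finrank ℝ E) * R := by
  have hg : gradSq V z ≤ Module.finrank ℝ E * R ^ 2 := by
    calc gradSq V z = ∑ i, ‖dx (stdOrthonormalBasis ℝ E i) V z‖ ^ 2 := rfl
      _ ≤ ∑ _i : Fin (Module.finrank ℝ E), R ^ 2 :=
          Finset.sum_le_sum fun i _ => pow_le_pow_left₀ (norm_nonneg _) (h i) 2
      _ = Module.finrank ℝ E * R ^ 2 := by simp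
  calc Real.sqrt (gradSq V z) ≤ Real.sqrt (Module.finrank ℝ E * R ^ 2) := Real.sqrt_le_sqrt hg
    _ = Real.sqrt (Module.finrank ℝ E) * R := by
        rw [Real.sqrt_mul (Nat.cast_nonneg _), Real.sqrt_sq hR]

/-- The norm of a vector is attained by pairing with a unit vector (or `0`). [folklore] -/
theorem exists_norm_le_one_inner_eq (x : F) : ∃ c : F, ‖c‖ ≤ 1 ∧ ⟪x, c⟫ = ‖x‖ := by
  by_cases hx : x = 0
  · exact ⟨0, by simp, by simp [hx]⟩
  · refine ⟨‖x‖⁻¹ • x, ?_, ?_⟩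
    · rw [norm_smul, norm_inv, norm_norm, inv_mul_cancel₀ (norm_ne_zero_iff.2 hx)]
    · rw [real_inner_smul_right, real_inner_self_eq_norm_sq, sq, ← mul_assoc,
        inv_mul_cancel₀ (norm_ne_zero_iff.2 hx), one_mul]

/-- **The pointwise estimate with a collar.** There is `C = C(E, c₁) > 0` such that: for
`u ∈ C²(U; F)` with `‖∂ₜu + Δₓu‖ ≤ c₁(‖u‖ + |∇ₓu|)` on the open `U`, `0 < ρ ≤ 1`, `0 < ε`,
`[s₀ - ε, s₀ + ρ²] × B̄(y₀, ρ) ⊆ U`, and `‖u‖ + |∇ₓu| ≤ S` on `[s₀, s₀ + ρ²] × B̄(y₀, ρ)`,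
`‖u(s₀, y₀)‖ + |∇ₓu(s₀, y₀)| ≤ C ρ S + C ρ^{-(d+3)} (∫_{[s₀-ε, s₀+ρ²] × B̄(y₀, ρ)} ‖u‖²)^{1/2}`.
[folklore] -/
theorem pointwise_estimate_collar {c₁ : ℝ} (hc₁ : 0 ≤ c₁) :
    ∃ C : ℝ, 0 < C ∧ ∀ {U : Set (ℝ × E)} {u : ℝ × E → F}, IsOpen U → ContDiffOn ℝ 2 u U →
      (∀ z ∈ U, ‖dt u z + lap u z‖ ≤ c₁ * (‖u z‖ + Real.sqrt (gradSq u z))) →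
      ∀ {s₀ : ℝ} {y₀ : E} {ρ ε : ℝ}, 0 < ρ → ρ ≤ 1 → 0 < ε →
      Icc (s₀ - ε) (s₀ + ρ ^ 2) ×ˢ closedBall y₀ ρ ⊆ U →
      ∀ {S : ℝ}, (∀ w ∈ Icc s₀ (s₀ + ρ ^ 2) ×ˢ closedBall y₀ ρ, ‖u w‖ + Real.sqrt (gradSq u w) ≤ S) →
      ‖u (s₀, y₀)‖ + Real.sqrt (gradSq u (s₀, y₀)) ≤
        C * ρ * S + C / ρ ^ (Module.finrank ℝ E + 3) *
          Real.sqrt (∫ w in Icc (s₀ - ε) (s₀ + ρ ^ 2) ×ˢ closedBall y₀ ρ, ‖u w‖ ^ 2) := by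
  obtain ⟨Ξ₁, M, hM, hΞs, hΞ01, hΞone, hΞsupp, hΞM⟩ := exists_parabolicProfile (E := E)
  obtain ⟨B, hB, hshell⟩ := exists_shell_bound (E := E)
  -- the constants (`d = dim E`, `V = |B(0,1)|`)
  have hV0 : 0 ≤ (volume (closedBall (0 : E) 1)).toReal := ENNReal.toReal_nonneg
  have hT0 : (0 : ℝ) ≤ (2 : ℝ) ^ ((Module.finrank ℝ E : ℝ) / 2) := Real.rpow_nonneg (by norm_num) _
  have hsd0 : 0 ≤ Real.sqrt (Module.finrank ℝ E : ℝ) := Real.sqrt_nonneg _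
  have hQ0 : 0 ≤ Real.sqrt ((c₁ + 2 * c₁ ^ 2) + 11 * M) := Real.sqrt_nonneg _
  obtain ⟨Kd, hKd_def⟩ : ∃ Kd : ℝ, Kd = (2 : ℝ) ^ ((Module.finrank ℝ E : ℝ) / 2) * 2 + 1 := ⟨_, rfl⟩
  have hKd1 : 1 ≤ Kd := by rw [hKd_def]; linarith
  have hKd0 : 0 ≤ Kd := zero_le_one.trans hKd1
  obtain ⟨KR, hKR_def⟩ : ∃ KR : ℝ, KR = B * Real.sqrt (volume (closedBall (0 : E) 1)).toReal *
      (6 * M + 8 * Real.sqrt M * Real.sqrt ((c₁ + 2 * c₁ ^ 2) + 11 * M)) := ⟨_, rfl⟩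
  have hKR0 : 0 ≤ KR := by rw [hKR_def]; positivity
  obtain ⟨C, hC_def⟩ : ∃ C : ℝ, C = (1 + Real.sqrt (Module.finrank ℝ E : ℝ)) * (c₁ * Kd + KR) + 1 :=
    ⟨_, rfl⟩
  have hprod0 : 0 ≤ (1 + Real.sqrt (Module.finrank ℝ E : ℝ)) * (c₁ * Kd + KR) := by positivity
  have hC0 : 0 < C := by rw [hC_def]; linarith
  have hC1 : (1 + Real.sqrt (Module.finrank ℝ E : ℝ)) * (c₁ * Kd) ≤ C := by
    rw [hC_def]
    have : 0 ≤ (1 + Real.sqrt (Module.finrank ℝ E : ℝ)) * KR := by positivity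
    nlinarith only [this]
  have hC2 : (1 + Real.sqrt (Module.finrank ℝ E : ℝ)) * KR ≤ C := by
    rw [hC_def]
    have : 0 ≤ (1 + Real.sqrt (Module.finrank ℝ E : ℝ)) * (c₁ * Kd) := by positivity
    nlinarith only [this]
  refine ⟨C, hC0, ?_⟩
  intro U u hU hu hineq s₀ y₀ ρ ε hρ hρ1 hε hbox S hS
  set d : ℕ := Module.finrank ℝ E with hd
  set V : ℝ := (volume (closedBall (0 : E) 1)).toReal with hV
  have hρ2 : 0 < ρ ^ 2 := by positivity
  have hρd : 0 < ρ ^ (d + 1) := pow_pos hρ _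
  have hρd3 : 0 < ρ ^ (d + 3) := pow_pos hρ _
  -- the cut-off
  obtain ⟨Θ, hΘs, hΘc, hΘsupp, hΘ01, hΘone, hΘM⟩ :=
    exists_localisedCutoff hΞs hΞ01 hΞone hΞsupp hΞM s₀ y₀ hρ hε
  -- sets
  set Kp : Set (ℝ × E) := Ioc s₀ (s₀ + ρ ^ 2) ×ˢ closedBall y₀ ρ with hKp
  set Cp : Set (ℝ × E) := Icc s₀ (s₀ + ρ ^ 2) ×ˢ closedBall y₀ ρ with hCp
  set box : Set (ℝ × E) := Icc (s₀ - ε) (s₀ + ρ ^ 2) ×ˢ closedBall y₀ ρ with hboxdef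
  have hKpCp : Kp ⊆ Cp := Set.prod_mono Ioc_subset_Icc_self Subset.rfl
  have hCpbox : Cp ⊆ box := Set.prod_mono (Icc_subset_Icc (by linarith) le_rfl) Subset.rfl
  have hKpbox : Kp ⊆ box := hKpCp.trans hCpbox
  have hboxc : IsCompact box := isCompact_Icc.prod (isCompact_closedBall _ _)
  have hKpm : MeasurableSet Kp := measurableSet_Ioc.prod measurableSet_closedBall
  have hS0 : 0 ≤ S := by
    have h := hS (s₀, y₀) ⟨⟨le_rfl, by linarith⟩, mem_closedBall_self hρ.le⟩
    exact le_trans (by positivity) h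
  -- volumes
  have hvolKp : volume Kp ≤ volume (closedBall (0 : E) 1) := by
    calc volume Kp ≤ volume Cp := measure_mono hKpCp
      _ = ENNReal.ofReal (s₀ + ρ ^ 2 - s₀) * volume (closedBall y₀ ρ) := volume_Icc_prod_closedBall _ _ _ _
      _ ≤ 1 * volume (closedBall (0 : E) 1) := by
          refine mul_le_mul' ?_ (volume_closedBall_le_unit y₀ hρ1)
          rw [show s₀ + ρ ^ 2 - s₀ = ρ ^ 2 by ring]
          exact ENNReal.ofReal_le_one.2 (by nlinarith)
      _ = volume (closedBall (0 : E) 1) := one_mul _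
  have hvolKp' : volume.real Kp ≤ V := ENNReal.toReal_mono measure_closedBall_lt_top.ne hvolKp
  have hvolKpfin : volume Kp ≠ ∞ := (hvolKp.trans_lt measure_closedBall_lt_top).ne
  -- `L² = ∫_box ‖u‖²`
  obtain ⟨cu, -, -, -⟩ := continuousOn_derivatives hU hu
  obtain ⟨-, cgsu⟩ := continuousOn_lap_gradSq hU hu
  have Ibox2 : IntegrableOn (fun w => ‖u w‖ ^ 2) box volume :=
    ((cu.norm.pow 2).mono hbox).integrableOn_compact hboxc
  set L : ℝ := Real.sqrt (∫ w in box, ‖u w‖ ^ 2) with hL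
  have hL0 : 0 ≤ L := Real.sqrt_nonneg _
  have hL2 : ∫ w in box, ‖u w‖ ^ 2 = L ^ 2 :=
    (Real.sq_sqrt (setIntegral_nonneg (measurableSet_Icc.prod measurableSet_closedBall)
      fun w _ => sq_nonneg _)).symm
  have hKp2 : ∫ w in Kp, ‖u w‖ ^ 2 ≤ L ^ 2 := by
    rw [← hL2]
    exact setIntegral_mono_set Ibox2 (Eventually.of_forall fun w => sq_nonneg _)
      (Eventually.of_forall hKpbox)
  -- `J₁ = ∫_{K⁺} ‖u‖ ≤ √V L`
  have hJ₁ : ∫ w in Kp, ‖u w‖ ≤ Real.sqrt V * L := by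
    have h := setIntegral_le_sqrt_measure_mul_setIntegral_sq hvolKpfin hKpm (f := fun w => ‖u w‖)
      (fun w _ => norm_nonneg _)
      ((cu.norm.mono (hKpbox.trans hbox)).aestronglyMeasurable hKpm)
      (Ibox2.mono_set hKpbox)
    refine h.trans ?_
    rw [← Real.sqrt_sq hL0, ← Real.sqrt_mul hV0]
    exact Real.sqrt_le_sqrt (mul_le_mul hvolKp' hKp2 (setIntegral_nonneg hKpm fun w _ => sq_nonneg _) hV0)
  -- `J₂ = ∫_{K⁺} |Θ| |∇u| ≤ √V · 2 √A L`, `A = (c₁ + 2c₁²) + 11M/ρ²`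
  set A : ℝ := (c₁ + 2 * c₁ ^ 2) + 11 * M / ρ ^ 2 with hA
  have hA0 : 0 ≤ A := by rw [hA]; positivity
  have hCacc : ∫ w in Kp, Θ w ^ 2 * gradSq u w ≤ 4 * A * L ^ 2 := by
    rw [← hL2]
    exact setIntegral_sq_mul_gradSq_le hU hu hc₁ hineq hρ hε hM hbox hΘs hΘc hΘsupp hΘ01 hΘM
  have hJ₂ : ∫ w in Kp, |Θ w| * Real.sqrt (gradSq u w) ≤ Real.sqrt V * (2 * Real.sqrt A * L) := by
    have cf : ContinuousOn (fun w => |Θ w| * Real.sqrt (gradSq u w)) U :=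
      hΘs.continuous.continuousOn.abs.mul (Real.continuous_sqrt.comp_continuousOn cgsu)
    have If2 : IntegrableOn (fun w => (|Θ w| * Real.sqrt (gradSq u w)) ^ 2) Kp volume := by
      have : IntegrableOn (fun w => Θ w ^ 2 * gradSq u w) Kp volume :=
        (((hΘs.continuous.pow 2).continuousOn.mul (cgsu.mono hbox)).integrableOn_compact hboxc).mono_set
          hKpbox
      refine this.congr_fun (fun w _ => ?_) hKpm
      rw [mul_pow, sq_abs, Real.sq_sqrt (gradSq_nonneg _ _)]
    have h := setIntegral_le_sqrt_measure_mul_setIntegral_sq hvolKpfin hKpm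
      (f := fun w => |Θ w| * Real.sqrt (gradSq u w))
      (fun w _ => mul_nonneg (abs_nonneg _) (Real.sqrt_nonneg _))
      ((cf.mono (hKpbox.trans hbox)).aestronglyMeasurable hKpm) If2
    refine h.trans ?_
    have e : ∫ w in Kp, (|Θ w| * Real.sqrt (gradSq u w)) ^ 2 = ∫ w in Kp, Θ w ^ 2 * gradSq u w := by
      refine setIntegral_congr_fun hKpm fun w _ => ?_
      rw [mul_pow, sq_abs, Real.sq_sqrt (gradSq_nonneg _ _)]
    rw [e]
    have h4 : Real.sqrt V * (2 * Real.sqrt A * L) = Real.sqrt (V * (4 * A * L ^ 2)) := by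
      rw [Real.sqrt_mul hV0, show (4 : ℝ) * A * L ^ 2 = (2 * L) ^ 2 * A by ring,
        Real.sqrt_mul (sq_nonneg _), Real.sqrt_sq (by positivity)]
      ring
    rw [h4]
    exact Real.sqrt_le_sqrt (mul_le_mul hvolKp' hCacc
      (setIntegral_nonneg hKpm fun w _ => mul_nonneg (sq_nonneg _) (gradSq_nonneg _ _)) hV0)
  -- the remainder
  have hsqA : Real.sqrt A ≤ Real.sqrt ((c₁ + 2 * c₁ ^ 2) + 11 * M) / ρ := by
    rw [le_div_iff₀ hρ, ← Real.sqrt_sq hρ.le, ← Real.sqrt_mul hA0]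
    refine Real.sqrt_le_sqrt ?_
    rw [hA, add_mul, div_mul_cancel₀ _ hρ2.ne']
    have : (c₁ + 2 * c₁ ^ 2) * ρ ^ 2 ≤ (c₁ + 2 * c₁ ^ 2) * 1 :=
      mul_le_mul_of_nonneg_left (by nlinarith only [hρ, hρ1]) (by positivity)
    linarith
  have hRle : B / ρ ^ (d + 1) * (6 * M / ρ ^ 2) * (∫ w in Kp, ‖u w‖) +
      B / ρ ^ (d + 1) * (4 * Real.sqrt M / ρ) * (∫ w in Kp, |Θ w| * Real.sqrt (gradSq u w)) ≤
      KR / ρ ^ (d + 3) * L := by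
    have h1 : B / ρ ^ (d + 1) * (6 * M / ρ ^ 2) * (∫ w in Kp, ‖u w‖) ≤
        B / ρ ^ (d + 1) * (6 * M / ρ ^ 2) * (Real.sqrt V * L) :=
      mul_le_mul_of_nonneg_left hJ₁ (by positivity)
    have h2 : B / ρ ^ (d + 1) * (4 * Real.sqrt M / ρ) * (∫ w in Kp, |Θ w| * Real.sqrt (gradSq u w)) ≤
        B / ρ ^ (d + 1) * (4 * Real.sqrt M / ρ) *
          (Real.sqrt V * (2 * (Real.sqrt ((c₁ + 2 * c₁ ^ 2) + 11 * M) / ρ) * L)) := by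
      refine mul_le_mul_of_nonneg_left (hJ₂.trans ?_) (by positivity)
      exact mul_le_mul_of_nonneg_left (mul_le_mul_of_nonneg_right
        (mul_le_mul_of_nonneg_left hsqA zero_le_two) hL0) (Real.sqrt_nonneg _)
    have e : B / ρ ^ (d + 1) * (6 * M / ρ ^ 2) * (Real.sqrt V * L) +
        B / ρ ^ (d + 1) * (4 * Real.sqrt M / ρ) *
          (Real.sqrt V * (2 * (Real.sqrt ((c₁ + 2 * c₁ ^ 2) + 11 * M) / ρ) * L)) =
        KR / ρ ^ (d + 3) * L := by
      rw [hKR_def, hV, div_eq_mul_inv, div_eq_mul_inv, div_eq_mul_inv, div_eq_mul_inv, div_eq_mul_inv,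
        show (ρ ^ (d + 3))⁻¹ = (ρ ^ (d + 1))⁻¹ * (ρ ^ 2)⁻¹ by rw [← mul_inv, ← pow_add],
        show (ρ ^ 2)⁻¹ = ρ⁻¹ * ρ⁻¹ by rw [← mul_inv, sq]]
      ring
    linarith only [h1, h2, e]
  -- the component bounds
  have hcomp := fun (c : F) (hc : ‖c‖ ≤ 1) =>
    component_bounds hU hu hc₁ hineq hρ hε hM hB (fun s y v hv w hw => hshell hρ hρ1 s y v hv w hw)
      hbox hΘs hΘc hΘsupp hΘ01 hΘone hΘM hS hc
  -- the value
  obtain ⟨c₀, hc₀, hc₀eq⟩ := exists_norm_le_one_inner_eq (u (s₀, y₀))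
  have hval : ‖u (s₀, y₀)‖ ≤ c₁ * Kd * ρ * S + KR / ρ ^ (d + 3) * L := by
    have h := (hcomp c₀ hc₀).1
    rw [hc₀eq, abs_of_nonneg (norm_nonneg _), ← hKp, ← hd] at h
    have h1 : ρ ^ 2 ≤ Kd * ρ := by nlinarith only [hρ, hρ1, hKd1]
    have h2 : c₁ * S * ρ ^ 2 ≤ c₁ * Kd * ρ * S := by
      calc c₁ * S * ρ ^ 2 = (c₁ * S) * ρ ^ 2 := by ring
        _ ≤ (c₁ * S) * (Kd * ρ) := mul_le_mul_of_nonneg_left h1 (mul_nonneg hc₁ hS0)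
        _ = c₁ * Kd * ρ * S := by ring
    linarith only [h, h2, hRle]
  -- the gradient components
  have hgrad : ∀ i, ‖dx (stdOrthonormalBasis ℝ E i) u (s₀, y₀)‖ ≤ c₁ * Kd * ρ * S + KR / ρ ^ (d + 3) * L := by
    intro i
    obtain ⟨cᵢ, hcᵢ, hcᵢeq⟩ := exists_norm_le_one_inner_eq (dx (stdOrthonormalBasis ℝ E i) u (s₀, y₀))
    have hb1 : ‖stdOrthonormalBasis ℝ E i‖ = 1 := (stdOrthonormalBasis ℝ E).orthonormal.1 i
    have h₀ := (hcomp cᵢ hcᵢ).2 _ hb1.le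
    rw [hcᵢeq, abs_of_nonneg (norm_nonneg _), hb1, mul_one, ← hKp] at h₀
    have h : ‖dx (stdOrthonormalBasis ℝ E i) u (s₀, y₀)‖ ≤
        c₁ * S * ((2 : ℝ) ^ ((d : ℝ) / 2) * (2 * ρ)) +
          (B / ρ ^ (d + 1) * (6 * M / ρ ^ 2) * (∫ w in Kp, ‖u w‖) +
            B / ρ ^ (d + 1) * (4 * Real.sqrt M / ρ) * (∫ w in Kp, |Θ w| * Real.sqrt (gradSq u w))) := h₀
    have h1 : (2 : ℝ) ^ ((d : ℝ) / 2) * (2 * ρ) ≤ Kd * ρ := by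
      rw [hKd_def, show (2 : ℝ) ^ ((d : ℝ) / 2) * (2 * ρ) = ((2 : ℝ) ^ ((d : ℝ) / 2) * 2) * ρ by ring]
      exact mul_le_mul_of_nonneg_right (by linarith only [hT0]) hρ.le
    have h2 : c₁ * S * ((2 : ℝ) ^ ((d : ℝ) / 2) * (2 * ρ)) ≤ c₁ * Kd * ρ * S := by
      calc c₁ * S * ((2 : ℝ) ^ ((d : ℝ) / 2) * (2 * ρ)) ≤ (c₁ * S) * (Kd * ρ) :=
            mul_le_mul_of_nonneg_left h1 (mul_nonneg hc₁ hS0)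
        _ = c₁ * Kd * ρ * S := by ring
    linarith only [h, h2, hRle]
  have hX0 : 0 ≤ c₁ * Kd * ρ * S + KR / ρ ^ (d + 3) * L := by positivity
  have hsq := sqrt_gradSq_le_of_forall_le hX0 hgrad
  -- conclusion
  have e1 : (1 + Real.sqrt (d : ℝ)) * (c₁ * Kd * ρ * S) ≤ C * ρ * S := by
    calc (1 + Real.sqrt (d : ℝ)) * (c₁ * Kd * ρ * S) = (1 + Real.sqrt (d : ℝ)) * (c₁ * Kd) * (ρ * S) := by
          ring
      _ ≤ C * (ρ * S) := mul_le_mul_of_nonneg_right hC1 (by positivity)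
      _ = C * ρ * S := by ring
  have e2 : (1 + Real.sqrt (d : ℝ)) * (KR / ρ ^ (d + 3) * L) ≤ C / ρ ^ (d + 3) * L := by
    calc (1 + Real.sqrt (d : ℝ)) * (KR / ρ ^ (d + 3) * L) = (1 + Real.sqrt (d : ℝ)) * KR * (L / ρ ^ (d + 3)) := by
          ring
      _ ≤ C * (L / ρ ^ (d + 3)) := mul_le_mul_of_nonneg_right hC2 (by positivity)
      _ = C / ρ ^ (d + 3) * L := by ring
  have hsum : ‖u (s₀, y₀)‖ + Real.sqrt (gradSq u (s₀, y₀)) ≤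
      (1 + Real.sqrt (d : ℝ)) * (c₁ * Kd * ρ * S) + (1 + Real.sqrt (d : ℝ)) * (KR / ρ ^ (d + 3) * L) := by
    have e : (1 + Real.sqrt (d : ℝ)) * (c₁ * Kd * ρ * S) + (1 + Real.sqrt (d : ℝ)) * (KR / ρ ^ (d + 3) * L) =
        (c₁ * Kd * ρ * S + KR / ρ ^ (d + 3) * L) +
          Real.sqrt (d : ℝ) * (c₁ * Kd * ρ * S + KR / ρ ^ (d + 3) * L) := by ring
    rw [e]
    exact add_le_add hval hsq
  exact hsum.trans (add_le_add e1 e2)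

/-- **The pointwise interior estimate for the backward heat inequality.** There is
`C = C(E, c₁) > 0` such that: for `u ∈ C²(U; F)` with `‖∂ₜu + Δₓu‖ ≤ c₁(‖u‖ + |∇ₓu|)` on the open
set `U`, `0 < ρ ≤ 1`, a collar width `ε > 0` with `[s₀ - ε, s₀ + ρ²] × B̄(y₀, ρ) ⊆ U`, and any
bound `‖u‖ + |∇ₓu| ≤ S` on the closed future cylinder `C⁺ = [s₀, s₀ + ρ²] × B̄(y₀, ρ)`,
`‖u(s₀, y₀)‖ + |∇ₓu(s₀, y₀)| ≤ C ρ S + C ρ^{-(d+3)} ‖u‖_{L²(C⁺)}`.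
(The collar enters only qualitatively: letting its width tend to zero in
`pointwise_estimate_collar`.) [folklore] -/
theorem pointwise_estimate {c₁ : ℝ} (hc₁ : 0 ≤ c₁) :
    ∃ C : ℝ, 0 < C ∧ ∀ {U : Set (ℝ × E)} {u : ℝ × E → F}, IsOpen U → ContDiffOn ℝ 2 u U →
      (∀ z ∈ U, ‖dt u z + lap u z‖ ≤ c₁ * (‖u z‖ + Real.sqrt (gradSq u z))) →
      ∀ {s₀ : ℝ} {y₀ : E} {ρ ε : ℝ}, 0 < ρ → ρ ≤ 1 → 0 < ε →
      Icc (s₀ - ε) (s₀ + ρ ^ 2) ×ˢ closedBall y₀ ρ ⊆ U →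
      ∀ {S : ℝ}, (∀ w ∈ Icc s₀ (s₀ + ρ ^ 2) ×ˢ closedBall y₀ ρ, ‖u w‖ + Real.sqrt (gradSq u w) ≤ S) →
      ‖u (s₀, y₀)‖ + Real.sqrt (gradSq u (s₀, y₀)) ≤
        C * ρ * S + C / ρ ^ (Module.finrank ℝ E + 3) *
          Real.sqrt (∫ w in Icc s₀ (s₀ + ρ ^ 2) ×ˢ closedBall y₀ ρ, ‖u w‖ ^ 2) := by
  obtain ⟨C, hC, h⟩ := pointwise_estimate_collar (E := E) (F := F) hc₁
  refine ⟨C, hC, ?_⟩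
  intro U u hU hu hineq s₀ y₀ ρ ε hρ hρ1 hε hbox S hS
  set d : ℕ := Module.finrank ℝ E with hd
  have hboxc : IsCompact (Icc (s₀ - ε) (s₀ + ρ ^ 2) ×ˢ closedBall y₀ ρ) :=
    isCompact_Icc.prod (isCompact_closedBall _ _)
  obtain ⟨cu, -, -, -⟩ := continuousOn_derivatives hU hu
  -- a bound for `‖u‖²` on the box
  obtain ⟨K₀, hK₀⟩ := hboxc.exists_bound_of_continuousOn (f := fun w => ‖u w‖ ^ 2)
    ((cu.norm.pow 2).mono hbox)
  have hK₀0 : 0 ≤ K₀ := le_trans (norm_nonneg _) (hK₀ (s₀, y₀)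
    ⟨⟨by linarith, by nlinarith only [hρ]⟩, mem_closedBall_self hρ.le⟩)
  have hVb0 : 0 ≤ volume.real (closedBall y₀ ρ) := measureReal_nonneg
  obtain ⟨D, hD_def⟩ : ∃ D : ℝ, D = C / ρ ^ (d + 3) := ⟨_, rfl⟩
  have hD0 : 0 ≤ D := by rw [hD_def]; positivity
  have hL0 : 0 ≤ Real.sqrt (∫ w in Icc s₀ (s₀ + ρ ^ 2) ×ˢ closedBall y₀ ρ, ‖u w‖ ^ 2) := Real.sqrt_nonneg _
  have Ibox2 : IntegrableOn (fun w => ‖u w‖ ^ 2) (Icc (s₀ - ε) (s₀ + ρ ^ 2) ×ˢ closedBall y₀ ρ) volume :=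
    ((cu.norm.pow 2).mono hbox).integrableOn_compact hboxc
  have hCpm : MeasurableSet (Icc s₀ (s₀ + ρ ^ 2) ×ˢ closedBall y₀ ρ) :=
    measurableSet_Icc.prod measurableSet_closedBall
  -- for every `0 < ε' ≤ ε`: the collar estimate with the split box integral
  have hstep : ∀ ε', 0 < ε' → ε' ≤ ε →
      ‖u (s₀, y₀)‖ + Real.sqrt (gradSq u (s₀, y₀)) ≤
        C * ρ * S + D * Real.sqrt (∫ w in Icc s₀ (s₀ + ρ ^ 2) ×ˢ closedBall y₀ ρ, ‖u w‖ ^ 2) +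
          D * Real.sqrt (K₀ * (ε' * volume.real (closedBall y₀ ρ))) := by
    intro ε' hε' hε'ε
    have hbox' : Icc (s₀ - ε') (s₀ + ρ ^ 2) ×ˢ closedBall y₀ ρ ⊆ Icc (s₀ - ε) (s₀ + ρ ^ 2) ×ˢ closedBall y₀ ρ :=
      Set.prod_mono (Icc_subset_Icc (by linarith) le_rfl) Subset.rfl
    have h1 := h hU hu hineq hρ hρ1 hε' (hbox'.trans hbox) hS
    rw [← hD_def] at h1
    -- split `[s₀ - ε', s₀ + ρ²] = [s₀ - ε', s₀) ∪ [s₀, s₀ + ρ²]`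
    have hunion : Icc (s₀ - ε') (s₀ + ρ ^ 2) ×ˢ closedBall y₀ ρ =
        Ico (s₀ - ε') s₀ ×ˢ closedBall y₀ ρ ∪ Icc s₀ (s₀ + ρ ^ 2) ×ˢ closedBall y₀ ρ := by
      rw [← Set.union_prod, Ico_union_Icc_eq_Icc (by linarith) (by nlinarith only [hρ])]
    have hdisj : Disjoint (Ico (s₀ - ε') s₀ ×ˢ closedBall y₀ ρ) (Icc s₀ (s₀ + ρ ^ 2) ×ˢ closedBall y₀ ρ) := by
      rw [Set.disjoint_prod]
      exact Or.inl (disjoint_left.2 fun x hx hx' => lt_irrefl _ (hx.2.trans_le hx'.1))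
    have hlowsub : Ico (s₀ - ε') s₀ ×ˢ closedBall y₀ ρ ⊆ Icc (s₀ - ε) (s₀ + ρ ^ 2) ×ˢ closedBall y₀ ρ :=
      Set.prod_mono (Ico_subset_Icc_self.trans (Icc_subset_Icc (by linarith) (by nlinarith only [hρ])))
        Subset.rfl
    have hCpsub : Icc s₀ (s₀ + ρ ^ 2) ×ˢ closedBall y₀ ρ ⊆ Icc (s₀ - ε) (s₀ + ρ ^ 2) ×ˢ closedBall y₀ ρ :=
      Set.prod_mono (Icc_subset_Icc (by linarith) le_rfl) Subset.rfl
    have hlow : ∫ w in Ico (s₀ - ε') s₀ ×ˢ closedBall y₀ ρ, ‖u w‖ ^ 2 ≤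
        K₀ * (ε' * volume.real (closedBall y₀ ρ)) := by
      have hfin : volume (Ico (s₀ - ε') s₀ ×ˢ closedBall y₀ ρ) < ∞ := by
        rw [volume_Ico_prod_closedBall]
        exact ENNReal.mul_lt_top ENNReal.ofReal_lt_top measure_closedBall_lt_top
      have h2 := norm_setIntegral_le_of_norm_le_const hfin (f := fun w => ‖u w‖ ^ 2) (C := K₀)
        fun w hw => hK₀ w (hlowsub hw)
      have hvol : volume.real (Ico (s₀ - ε') s₀ ×ˢ closedBall y₀ ρ) = ε' * volume.real (closedBall y₀ ρ) := by
        rw [measureReal_def, volume_Ico_prod_closedBall, ENNReal.toReal_mul,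
          ENNReal.toReal_ofReal (by linarith), show s₀ - (s₀ - ε') = ε' by ring]
        rfl
      rw [hvol] at h2
      exact (le_abs_self _).trans ((Real.norm_eq_abs _).symm.trans_le h2)
    have hsplit : ∫ w in Icc (s₀ - ε') (s₀ + ρ ^ 2) ×ˢ closedBall y₀ ρ, ‖u w‖ ^ 2 ≤
        (Real.sqrt (∫ w in Icc s₀ (s₀ + ρ ^ 2) ×ˢ closedBall y₀ ρ, ‖u w‖ ^ 2)) ^ 2 +
          K₀ * (ε' * volume.real (closedBall y₀ ρ)) := by
      rw [hunion, setIntegral_union hdisj hCpm (Ibox2.mono_set hlowsub) (Ibox2.mono_set hCpsub),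
        Real.sq_sqrt (setIntegral_nonneg hCpm fun w _ => sq_nonneg _)]
      linarith only [hlow]
    have hsqrt : Real.sqrt (∫ w in Icc (s₀ - ε') (s₀ + ρ ^ 2) ×ˢ closedBall y₀ ρ, ‖u w‖ ^ 2) ≤
        Real.sqrt (∫ w in Icc s₀ (s₀ + ρ ^ 2) ×ˢ closedBall y₀ ρ, ‖u w‖ ^ 2) +
          Real.sqrt (K₀ * (ε' * volume.real (closedBall y₀ ρ))) := by
      refine (Real.sqrt_le_sqrt hsplit).trans ?_
      refine (sqrt_add_le_sqrt_add_sqrt (sq_nonneg _) (by positivity)).trans (le_of_eq ?_)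
      rw [Real.sqrt_sq hL0]
    have h3 := mul_le_mul_of_nonneg_left hsqrt hD0
    rw [mul_add] at h3
    linarith only [h1, h3]
  -- let `ε' → 0`
  refine le_of_forall_pos_le_add fun δ hδ => ?_
  obtain ⟨ε', hε'_def⟩ : ∃ ε' : ℝ, ε' = min ε (δ ^ 2 / (D ^ 2 * K₀ * volume.real (closedBall y₀ ρ) + 1)) :=
    ⟨_, rfl⟩
  have hden : 0 < D ^ 2 * K₀ * volume.real (closedBall y₀ ρ) + 1 := by positivity
  have hε'0 : 0 < ε' := by rw [hε'_def]; exact lt_min hε (div_pos (pow_pos hδ 2) hden)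
  have hε'ε : ε' ≤ ε := by rw [hε'_def]; exact min_le_left _ _
  have hε'le : ε' ≤ δ ^ 2 / (D ^ 2 * K₀ * volume.real (closedBall y₀ ρ) + 1) := by
    rw [hε'_def]; exact min_le_right _ _
  have hsmall : D * Real.sqrt (K₀ * (ε' * volume.real (closedBall y₀ ρ))) ≤ δ := by
    rw [← Real.sqrt_sq hD0, ← Real.sqrt_mul (sq_nonneg _)]
    refine (Real.sqrt_le_sqrt ?_).trans (le_of_eq (Real.sqrt_sq hδ.le))
    have h2 : D ^ 2 * K₀ * volume.real (closedBall y₀ ρ) * ε' ≤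
        D ^ 2 * K₀ * volume.real (closedBall y₀ ρ) *
          (δ ^ 2 / (D ^ 2 * K₀ * volume.real (closedBall y₀ ρ) + 1)) :=
      mul_le_mul_of_nonneg_left hε'le (by positivity)
    have h3 : D ^ 2 * K₀ * volume.real (closedBall y₀ ρ) *
        (δ ^ 2 / (D ^ 2 * K₀ * volume.real (closedBall y₀ ρ) + 1)) ≤ δ ^ 2 := by
      rw [mul_div_assoc', div_le_iff₀ hden]
      have : 0 ≤ D ^ 2 * K₀ * volume.real (closedBall y₀ ρ) := by positivity
      nlinarith only [this, sq_nonneg δ]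
    calc D ^ 2 * (K₀ * (ε' * volume.real (closedBall y₀ ρ)))
        = D ^ 2 * K₀ * volume.real (closedBall y₀ ρ) * ε' := by ring
      _ ≤ δ ^ 2 := h2.trans h3
  have h := hstep ε' hε'0 hε'ε
  rw [← hD_def]
  linarith only [h, hsmall]

end Assembly

end Carleman

end Literature.Analysis.FluidPDE
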